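import Literature.MathematicalPhysics.QuantumFieldTheory.Balaban1983to89.B4Lower18Regular

/-!
# [B4] (1.8) ON UNIONS OF UNIT BLOCKS FOR REGULAR NON-CONSTANT CONFIGURATIONS: the decoupling (2.26) into unit cubes with BLOCKWISE constant backgrounds, and the printed regularity (1.7)

T. Bałaban, *Regularity and decay of lattice Green's functions*, Commun. Math. Phys. **89** (1983) 571–597
[cite: Balaban1983RegularityDecay] (= [B4]; journal page = PDF page + 570).  Cell unit `b2b-balaban-b04` gen 13
(claim G-B4-18-REGULAR-REGION), written over `B4Lower18Regular` (this lineage: (1.8) at `A ≠ 0` on fine BOXES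
about ONE constant background, with the abstract quadratic-form perturbation lemma `covOp_kmul_form_ge_quarter`),
`B4GaugeCovariance` ([B4]'s operator `b4Op` for an arbitrary link field and its gauge covariance) and `B4Lower18`
(fine regions `fineDom`, the block Poincaré machinery).  This file removes the two main scope restrictions of
`B4Lower18Regular`: the region is now an ARBITRARY finite union `Ω` of unit blocks (as (1.8) demands: «The constant
γ₀ is independent of the lattice spacing η, as well as of Ω and of A.»), and regularity is the PRINTED (1.7) on a
vector field given in component form — the blockwise (2.23) being DERIVED, cube by cube, by telescoping.

## THE PRINTED TEXT (verbatim «…»)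

p. 572: «We consider subsets Ω which are unions of big blocks.»; vector fields = real-valued functions on bonds
(p. 572, transcript paraphrase) with «A_{⟨x,x+ηe_μ⟩} = A_μ(x)»; (1.4) with the oriented contours `Γ^{(k)}_{y,x}` in
`B^k(y)` from `y` to `x` (p. 572, transcript paraphrase); (1.7)
«|(∂^η_μ A)(x)| ≤ c e^{β−1}, x ∈ Ω, μ = 1,…,d, β > 0», p. 573 «(∂^η_μA)(x) = η^{−1}(A(x+ηe_μ) − A(x))».
(1.8), p. 573: «there exists a positive constant γ₀ such that for e sufficiently small and for a regular vector
field A (1.8) −Δ^{η,N}_{A,Ω} + aP_k(A) ≥ γ₀ I. The constant γ₀ is independent of the lattice spacing η, as well as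
of Ω and of A.»  Proof mechanism, pp. 579–580: (2.23) «A = A₀ + A', |A'|, |∂^η_μA'| ≤ c'e^{β−1}», «c' depends on
c and M»; «Using the same gauge transformation as in the proof of Lemma 2.4, we reduce them to the case A₀ = 0. Now
these bounds are consequences of quadratic form considerations. At first let us notice that □ is a sum of unit cubes
Δ and we have» (2.26)bis «⟨φ, (−Δ^{η,N}_□ + m_k² + a_kP_k)φ⟩ ≥ Σ_{Δ⊂□} ⟨φ, (−Δ^{η,N}_Δ + a_kP_k)φ⟩» and (2.27)
«⟨φ, (−Δ^{η,N}_Δ + a_kP_k)φ⟩ ≥ min{π², a_k}‖φ‖_{L²(Δ)}».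

## DICTIONARY (as in `B4GaugeCovariance` / `B4Lower18` / `B4Lower18Regular`)

Lattice units: `η = 1/n`, `n = L^k`; the unit cube `Δ(y) = B^k(y)` of (1.1) is `B(y) = {x ∈ ℤ^{d+1} : ⌊x/n⌋ = y}`
(`blk n x = y`), and for a finite set `Ωc ⊂ ℤ^{d+1}` of unit labels `Ω = ⋃_{y∈Ωc} B(y)` is `fineDom n Ωc`.
`−Δ^{η,N}_{A,Ω}` (Neumann: all nearest-neighbour bonds with both ends in `Ω`) carries the weight `n²/2` per ORIENTED
pair (`regWt`); `a_kP_k(A) = a·n^{−(d+1)}·Q^*Q` with block sums over `B(y)`, `y ∈ Ωc` (`rBlkWt`) and transporters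
`U(A(Γ_{y,x}))` (`contourTrans`; the staircase system `rstairContour` from the base corner `n·y`); link variables
`U(A_b) = F.U(κA_b)` for an orthogonal one-parameter flow `F` (`OrthFlow`), `κ = eη = e/n`; forms are divided by
the common volume factor.  A vector field in component form `A_ν(x)` on `ℤ^{d+1}` is the bond function `compField`
(`A(x,x+e_ν) = A_ν(x)`, `A(x+e_ν,x) = −A_ν(x)`), and (1.7) in lattice units reads `|A_ν(x+e_μ) − A_ν(x)| ≤ c e^{β−1}/n`.

## WHAT IS CERTIFIED (kernel, sorry-free; every hypothesis explicit)

* §1 LOCALITY AND MONOTONICITY of [B4]'s operator: `covOp_congr` / `transport_congr` (the operator depends on the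
  link variables only on weighted bonds and contour steps); **`covLap_form_mono` / `covOp_form_mono`** — dropping
  (or lowering the weight of) bonds lowers the form (1.3): this is (2.26)bis «⟨φ, (−Δ^{η,N}_□ + m_k² + a_kP_k)φ⟩ ≥
  Σ_{Δ⊂□} ⟨φ, (−Δ^{η,N}_Δ + a_kP_k)φ⟩» for an ARBITRARY link field; `pertT_bound_gen`; `abs_sub_le_of_pathRel`.
* §2–§3 THE DECOUPLED ZERO-FIELD BOUND on `Ω = fineDom n Ωc`: weights `regWt` (Neumann bonds of `Ω`), `decWt`
  (intra-block bonds only), `rBlkWt` (block sums); **`lower18_zero_dec`**: `Σ_{Δ⊂Ω}(−Δ^{η,N}_Δ + a_kP_Δ) ≥ min(2,a)`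
  ((2.27) summed over the unit cubes; block Poincaré on the intra-block bonds, constant `2` for the printed `π²` —
  cf. the cell's GAPS G-B4-03).
* §4 BLOCKWISE CONSTANT BACKGROUNDS `A₀(Δ)` (`blockConst`): on intra-block bonds the link variables and the block
  transporters of `A₀(Δ)` are gauge-trivial (`fieldLink_blockConst_same`, `contourTrans_blockConst`, block gauge
  `blockGaugeFn`), so the DECOUPLED operator at a blockwise-constant configuration is a gauge transform of the
  zero-field one (`b4Op_blockConst_dec`) and its massless form is `≥ min(2,a)|Φ|²` (`background_form_ge_region`).
* §5 **`lower18_regular_region`**: for a Lipschitz flow `|(U(t) − 1)v| ≤ ℓ|t||v|`, ANY finite `Ωc`, any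
  configuration `A` on `Ω` with `|κ(A − A₀(Δ))_b| ≤ θ/n` on the nearest-neighbour bonds of each unit cube `Δ` for SOME
  constants `A₀(Δ)`, any contour system whose weighted contours start in, stay in and end at the target in their
  block with `|Γ_{y,x}| ≤ (d+1)n`, and `ℓ²θ²(d+1)(1 + a(d+1)) ≤ min(2,a)/4`:
  `⟨Φ, (−Δ^{η,N}_{A,Ω} + m² + a_kP_k(A))Φ⟩ ≥ (min(2,a)/4 + m²)|Φ|²` (`pertE_site_bound_dec`: `ε₁ = (d+1)ℓ²θ²`).
* §6 THE STAIRCASE CONTOUR SYSTEM of a region (`rbaseEmb`, `rstairContour`, `_end/_path/_length`):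
  **`lower18_regular_region_stair`** has NO contour hypothesis; `green_region_l2_bound`: `G_k(Ω,A)` exists and
  `(min(2,a)/4 + m²)²‖G_k(Ω,A)f‖₂² ≤ ‖f‖₂²` — Lemma 2.1 (2.15), first member, on regions.
* §7 **(1.7) ⇒ (2.23) PER UNIT CUBE**: `compField` (component form), `abs_comp_sub_base_le` (telescoping along the
  staircase from the cube's base corner, `≤ (d+1)n` steps), `regular17_blockwise`: (1.7) in lattice units with
  constant `δ` gives `|A_b − A₀(Δ)_b| ≤ (d+1)nδ` on intra-block bonds with `A₀(Δ) := A(n·y)` (`baseConst`), i.e.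
  `c' = (d+1)c`; **`lower18_regular_region_printed`**: charge `e > 0`, `κ = e/n`, (1.7) with `c e^{β−1}/n`,
  smallness `ℓ²((d+1)c e^β)²(d+1)(1+a(d+1)) ≤ min(2,a)/4` ⇒ the form bound on `Ω`.
* §8 THE TYPED CLAIM: `B4.Claim18Printed` (typed `∃ γ₀ e₁ > 0, ∀ i, regular → 0 < e → e ≤ e₁ → lower18 γ₀`) HOLDS
  on the regular-region family `regularRegionSetting F a c β` — instances `(n, Ωc, e, A)`: ALL scales, ALL finite
  unions of unit blocks, the instance's own charge, ALL vector fields in component form; `regular` := the printed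
  (1.7) in lattice units on `Ω`; `lower18 γ` := the form inequality at mass `0` with `κ = e/n` — by
  **`claim18Printed_regularRegion`** (any Lipschitz flow, `a > 0`, `c ≥ 0`, `β > 0`; witnesses `γ₀ = min(2,a)/4`
  and the `e₁` of `B4Lower18Regular.threshold_exists` for `c' = (d+1)c`) and `claim18Printed_regularRegion_rot`
  (rotation flow; hypotheses `a > 0`, `c ≥ 0`, `β > 0` only).  `regularRegionSetting_regular_iff` / `_lower18_iff` /
  `_e` display the three fields.

## HONEST SCOPE / DIVERGENCES (recorded in the cell's DIVERGENCES.md)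

1. REGION: every finite union of UNIT blocks of `ℤ^{d+1} ≅ ηℤ^{d+1}` (this contains [B4]'s unions of big blocks in
   `ηZ^d`); the TORUS `T_η` variant of p. 572 (periodic identification) is not typed.
2. REGULARITY: (1.7) typed componentwise in lattice units for a vector field in component form on the whole
   lattice (values outside `Ω` enter only through `A_ν(x + e_μ)`, `x ∈ Ω`, as in print); the backgrounds are taken
   per UNIT cube (`c' = (d+1)c`), [B4] takes them per big block («c' depends on c and M»); the `|∂^η_μA'|` member of
   (2.23) is not used.
3. CONSTANTS: `γ₀ = min(2,a)/4` (printed: an unspecified `γ₀`; `min(2,a)` is the lineage's zero-field constant —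
   cf. GAPS G-B4-03 on the printed `min{π², a_k}`); `e₁` explicit in `ℓ, (d+1)c, β, a, d`.
4. METHOD: (2.26)bis is certified as monotonicity of the form in the bond weights for an arbitrary link field, the
   blockwise backgrounds are gauged away cube by cube, and the perturbation is controlled by quadratic forms
   (`B4Lower18Regular`, Cauchy–Schwarz with weight `1/2`) instead of `‖G_k^{1/2}V_kG_k^{1/2}‖_{2,2} ≤ O(1)e^β`.
5. FLOW: any orthogonal one-parameter flow with the Lipschitz hypothesis (for `U = exp(tq)`: `ℓ = ‖q‖`), witnessed
   by the rotation flow; `Matrix.exp` is not used (as in `B4GaugeCovariance`).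
6. NOT certified: (2.15) members 2–4, (2.25)/(2.29), Lemma 2.2, Corollary 2.3 and the Theorem (1.9)–(1.12) at `A ≠ 0`.

Value = kernel certificate of a published lemma's statement ((1.8) with (1.7)) on an explicit model family; NOT summit progress.

v1.1 (DOCFIX, docstring-only; answer to XREAD ref6-g32, CLAIMS.log l.49490, item V1): the two phrases 'vector fields =
real-valued functions on bonds' and 'oriented contours Γ^{(k)}_{y,x} in B^k(y) from y to x' are TRANSCRIPT PARAPHRASES of
p. 572, not print, and are no longer marked as quotations (header, §6, §7); no Lean declaration changed.
-/

namespace Literature.MathematicalPhysics.QuantumFieldTheory.Balaban1983to89.B4Lower18RegularRegion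

open Matrix Finset Kronecker
open Literature.MathematicalPhysics.QuantumFieldTheory.Balaban1983to89.B4GaugeCovariance
open Literature.MathematicalPhysics.QuantumFieldTheory.Balaban1983to89.B4Lower18Regular

section Generic

variable {X Y ι : Type*}

/-! ## §1 Locality of [B4]'s operator in the link variables; dropping bonds lowers the form (1.3) -/

/-- the covariant bond difference over `(x, y)` depends on the link variables only through `W(x,y)`. [folklore] -/
theorem bondDiff_congr [DecidableEq X] [DecidableEq ι] {W W' : X → X → Matrix ι ι ℝ} {x y : X}
    (h : W x y = W' x y) : bondDiff W x y = bondDiff W' x y := by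
  unfold bondDiff
  simp only [h]

/-- `−Δ_W` depends on the link variables only on weighted pairs. [folklore] -/
theorem covLap_congr [Fintype X] [Fintype ι] [DecidableEq X] [DecidableEq ι] {c : X → X → ℝ}
    {W W' : X → X → Matrix ι ι ℝ} (h : ∀ x y, c x y ≠ 0 → W x y = W' x y) : covLap c W = covLap c W' := by
  unfold covLap
  refine Finset.sum_congr rfl fun x _ => Finset.sum_congr rfl fun y _ => ?_
  by_cases hc : c x y = 0
  · rw [hc, zero_smul, zero_smul]
  · rw [bondDiff_congr (h x y hc)]

/-- `P_k = Q_k^*Q_k` depends on the transporters only on block pairs. [folklore] -/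
theorem projOp_congr [Fintype Y] [Fintype ι] {q : Y → X → ℝ} {T T' : Y → X → Matrix ι ι ℝ}
    (h : ∀ y x, q y x ≠ 0 → T y x = T' y x) : projOp q T = projOp q T' := by
  rw [projOp, projOp, avgOp_congr h]

/-- `H(W, T)` depends on `W` only on weighted pairs and on `T` only on block pairs. [folklore] -/
theorem covOp_congr [Fintype X] [Fintype Y] [Fintype ι] [DecidableEq X] [DecidableEq ι] {c : X → X → ℝ}
    (m2 a : ℝ) {q : Y → X → ℝ} {W W' : X → X → Matrix ι ι ℝ} {T T' : Y → X → Matrix ι ι ℝ}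
    (hW : ∀ x y, c x y ≠ 0 → W x y = W' x y) (hT : ∀ y x, q y x ≠ 0 → T y x = T' y x) :
    covOp c m2 a q W T = covOp c m2 a q W' T' := by
  rw [covOp, covOp, covLap_congr hW, projOp_congr hT]

/-- transport along a contour with `r`-steps depends on the link variables only on `r`-bonds. [folklore] -/
theorem transport_congr [Fintype ι] [DecidableEq ι] {r : X → X → Prop} {W W' : X → X → Matrix ι ι ℝ}
    (h : ∀ u v, r u v → W u v = W' u v) : ∀ (x : X) (l : List X), PathRel r x l →
      transport W x l = transport W' x l := by
  intro x l
  induction l generalizing x with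
  | nil => intro _; simp [transport]
  | cons y l ih =>
      rintro ⟨hxy, hl⟩
      rw [transport, transport, h x y hxy, ih y hl]

/-- weakening the step relation of a contour. [folklore] -/
theorem pathRel_mono {r r' : X → X → Prop} (h : ∀ u v, r u v → r' u v) : ∀ (x : X) (l : List X),
    PathRel r x l → PathRel r' x l := by
  intro x l
  induction l generalizing x with
  | nil => intro _; trivial
  | cons y l ih =>
      rintro ⟨hxy, hl⟩
      exact ⟨h x y hxy, ih y hl⟩

/-- a contour with `r`-steps all of whose sites satisfy `P` has `(r ∧ P)`-steps. [folklore] -/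
theorem pathRel_and {r : X → X → Prop} {P : X → Prop} : ∀ (x : X) (l : List X), PathRel r x l →
    (∀ z ∈ l, P z) → PathRel (fun u v => r u v ∧ P v) x l := by
  intro x l
  induction l generalizing x with
  | nil => intros; trivial
  | cons y l ih =>
      rintro ⟨hxy, hl⟩ hP
      exact ⟨⟨hxy, hP y (List.mem_cons_self ..)⟩, ih y hl fun z hz => hP z (List.mem_cons_of_mem _ hz)⟩

/-- a contour whose start satisfies `P` and whose steps are `(r ∧ P(end))`-bonds has `(P(start) ∧ r ∧ P(end))`-steps
("the contour stays in the block"). [folklore] -/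
theorem pathRel_chain {r : X → X → Prop} {P : X → Prop} : ∀ (x : X) (l : List X), P x →
    PathRel (fun u v => r u v ∧ P v) x l → PathRel (fun u v => P u ∧ (r u v ∧ P v)) x l := by
  intro x l
  induction l generalizing x with
  | nil => intros; trivial
  | cons y l ih =>
      rintro hx ⟨hxy, hl⟩
      exact ⟨⟨hx, hxy⟩, ih y hxy.2 hl⟩

/-- TELESCOPING along a contour: if `|f(v) − f(u)| ≤ δ` on `r`-bonds then `|f(end) − f(start)| ≤ |Γ|·δ`
([B4] p. 579: (1.7) on the bonds of a block gives (2.23) «c' depends on c and M»). [folklore] -/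
theorem abs_sub_le_of_pathRel {r : X → X → Prop} {f : X → ℝ} {δ : ℝ} (h : ∀ u v, r u v → |f v - f u| ≤ δ) :
    ∀ (x : X) (l : List X), PathRel r x l → |f (pathEnd x l) - f x| ≤ l.length * δ := by
  intro x l
  induction l generalizing x with
  | nil => intro _; simp [pathEnd]
  | cons y l ih =>
      rintro ⟨hxy, hl⟩
      rw [pathEnd, List.length_cons, Nat.cast_succ, add_mul, one_mul]
      calc |f (pathEnd y l) - f x| ≤ |f (pathEnd y l) - f y| + |f y - f x| := abs_sub_le _ _ _
        _ ≤ l.length * δ + δ := add_le_add (ih y hl) (h x y hxy)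

/-- **DROPPING BONDS LOWERS THE FORM (1.3)** ([B4] p. 580 «□ is a sum of unit cubes Δ and we have» (2.26)
«⟨φ, (−Δ^{η,N}_□ + m_k² + a_kP_k)φ⟩ ≥ Σ_{Δ⊂□} ⟨φ, (−Δ^{η,N}_Δ + a_kP_k)φ⟩»): `c' ≤ c` bondwise ⇒
`⟨Φ, (−Δ^{c'}_W)Φ⟩ ≤ ⟨Φ, (−Δ^{c}_W)Φ⟩`. [cite: Balaban1983RegularityDecay, p. 580] -/
theorem covLap_form_mono [Fintype X] [Fintype ι] [DecidableEq X] [DecidableEq ι] {c c' : X → X → ℝ}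
    (hle : ∀ x y, c' x y ≤ c x y) (W : X → X → Matrix ι ι ℝ) (Φ : X × ι → ℝ) :
    Φ ⬝ᵥ (covLap c' W *ᵥ Φ) ≤ Φ ⬝ᵥ (covLap c W *ᵥ Φ) := by
  rw [covLap_form, covLap_form]
  exact Finset.sum_le_sum fun x _ => Finset.sum_le_sum fun y _ =>
    mul_le_mul_of_nonneg_right (hle x y) (dotProduct_self_nonneg' _)

/-- `H` with fewer bonds is a smaller form. [cite: Balaban1983RegularityDecay, p. 580 (2.26)] -/
theorem covOp_form_mono [Fintype X] [Fintype Y] [Fintype ι] [DecidableEq X] [DecidableEq ι]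
    {c c' : X → X → ℝ} (hle : ∀ x y, c' x y ≤ c x y) (m2 a : ℝ) (q : Y → X → ℝ)
    (W : X → X → Matrix ι ι ℝ) (T : Y → X → Matrix ι ι ℝ) (Φ : X × ι → ℝ) :
    Φ ⬝ᵥ (covOp c' m2 a q W T *ᵥ Φ) ≤ Φ ⬝ᵥ (covOp c m2 a q W T *ᵥ Φ) := by
  rw [covOp_form, covOp_form]
  have h := covLap_form_mono hle W Φ
  linarith

/-- transport perturbation bound along an `r`-contour of length `≤ (d+1)n` with `|κA'_b| ≤ θ/n` on `r`-bonds: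
`|(U(κA'(Γ)) − 1)v|² ≤ (ℓ(d+1)θ)²|v|²` (generic-site version of `B4Lower18Regular.pertT_bound`).
[cite: Balaban1983RegularityDecay, p. 580] -/
theorem pertT_bound_gen [Fintype ι] [DecidableEq ι] (F : OrthFlow ι) {ℓ : ℝ} (hℓ : 0 ≤ ℓ)
    (hLip : ∀ t (v : ι → ℝ), ((F.U t - 1) *ᵥ v) ⬝ᵥ ((F.U t - 1) *ᵥ v) ≤ (ℓ * t) ^ 2 * (v ⬝ᵥ v))
    (κ : ℝ) {n : ℕ} (hn : 1 ≤ n) {d : ℕ} {r : X → X → Prop} {A' : X → X → ℝ} {θ : ℝ} (hθ : 0 ≤ θ)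
    (hA' : ∀ u v, r u v → |κ * A' u v| ≤ θ / n) {x₀ : X} {l : List X} (hl : PathRel r x₀ l)
    (hlen : (l.length : ℝ) ≤ (d + 1) * n) (v : ι → ℝ) :
    ((transport (fieldLink F κ A') x₀ l - 1) *ᵥ v) ⬝ᵥ ((transport (fieldLink F κ A') x₀ l - 1) *ᵥ v)
      ≤ (ℓ * ((d + 1) * θ)) ^ 2 * (v ⬝ᵥ v) := by
  have hn0 : (0 : ℝ) < n := by exact_mod_cast hn
  rw [transport_fieldLink]
  refine (hLip _ v).trans (mul_le_mul_of_nonneg_right ?_ (dotProduct_self_nonneg' v))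
  have h1 : |κ * lsum A' x₀ l| ≤ (d + 1) * θ := by
    refine (abs_lsum_le hA' x₀ l hl).trans ?_
    calc (l.length : ℝ) * (θ / n) ≤ (d + 1) * n * (θ / n) :=
          mul_le_mul_of_nonneg_right hlen (div_nonneg hθ hn0.le)
      _ = (d + 1) * θ := by field_simp
  have h2 : |ℓ * (κ * lsum A' x₀ l)| ≤ ℓ * ((d + 1) * θ) := by
    rw [abs_mul, abs_of_nonneg hℓ]
    exact mul_le_mul_of_nonneg_left h1 hℓ
  exact sq_le_sq' (by linarith [abs_nonneg (ℓ * (κ * lsum A' x₀ l)), neg_abs_le (ℓ * (κ * lsum A' x₀ l))])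
    (le_of_abs_le h2)

end Generic

section Region

/-! ## §2 Regions `Ω` that are unions of unit blocks: bond weights, decoupled (intra-block) weights, block weights -/

open Literature.MathematicalPhysics.QuantumFieldTheory.Balaban1983to89.B4Reflection242
  (nbrs blk mem_nbrs nbrs_comm not_mem_nbrs_self card_nbrs)
open Literature.MathematicalPhysics.QuantumFieldTheory.Balaban1983to89.B4Lower18
  (IsBlockUnion fineDom mem_fineDom fineDom_isBlockUnion rblk card_filter_rblk RBond rsrc rtgt rbond_injective
    rbond_anti rblock_poincare rblock_var_eq_zero_one sum_ind_mul_ind)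
open Literature.MathematicalPhysics.QuantumFieldTheory.Balaban1983to89.Beta.BlockPoincare (avg coercive_lap_blocks)
open Literature.MathematicalPhysics.QuantumFieldTheory.Balaban1983to89.Beta.CombesThomasForm (lap lap_apply)

variable {d : ℕ}

/-- [B4]'s BOND WEIGHTS of (1.3) on a region `R ⊂ ℤ^{d+1}` of fine points (lattice units, Neumann bonds):
`n²/2` per ordered nearest-neighbour pair of `R` (`B4GaugeCovariance.boxWt` is the case of a box).
[cite: Balaban1983RegularityDecay, p. 572 (1.3), dictionary] -/
noncomputable def regWt (n : ℕ) (R : Finset (Fin (d + 1) → ℤ)) : ↥R → ↥R → ℝ :=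
  fun x y => (n : ℝ) ^ 2 / 2 * (if y.1 ∈ nbrs x.1 then 1 else 0)

/-- THE DECOUPLED WEIGHTS: only nearest-neighbour pairs INSIDE ONE UNIT BLOCK (the bonds of `−Δ^{η,N}_Δ`,
`Δ` a unit cube, in (2.26) «Σ_{Δ⊂□} ⟨φ, (−Δ^{η,N}_Δ + a_kP_k)φ⟩»). [cite: Balaban1983RegularityDecay, p. 580 (2.26)] -/
noncomputable def decWt (n : ℕ) (R : Finset (Fin (d + 1) → ℤ)) : ↥R → ↥R → ℝ :=
  fun x y => (n : ℝ) ^ 2 / 2 * (if y.1 ∈ nbrs x.1 ∧ blk n y.1 = blk n x.1 then 1 else 0)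

/-- [B4]'s BLOCK WEIGHTS of (1.4) over a set `Ωc` of unit labels: `q(y, x) = 1[x ∈ B(y)]`.
[cite: Balaban1983RegularityDecay, p. 572 (1.4), dictionary] -/
noncomputable def rBlkWt (n : ℕ) (Ωc R : Finset (Fin (d + 1) → ℤ)) : ↥Ωc → ↥R → ℝ :=
  fun y x => if blk n x.1 = y.1 then 1 else 0

/-- the Neumann bond weights are non-negative. [folklore] -/
theorem regWt_nonneg (n : ℕ) (R : Finset (Fin (d + 1) → ℤ)) (x y : ↥R) : 0 ≤ regWt n R x y := by
  unfold regWt; split_ifs <;> positivity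

/-- the decoupled bond weights are non-negative. [folklore] -/
theorem decWt_nonneg (n : ℕ) (R : Finset (Fin (d + 1) → ℤ)) (x y : ↥R) : 0 ≤ decWt n R x y := by
  unfold decWt; split_ifs <;> positivity

/-- dropping the inter-block bonds. [folklore] -/
theorem decWt_le_regWt (n : ℕ) (R : Finset (Fin (d + 1) → ℤ)) (x y : ↥R) : decWt n R x y ≤ regWt n R x y := by
  unfold decWt regWt
  refine mul_le_mul_of_nonneg_left ?_ (by positivity)
  split_ifs with h1 h2
  · exact le_rfl
  · exact absurd h1.1 h2
  · norm_num
  · exact le_rfl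

/-- the decoupled bond weights are symmetric. [folklore] -/
theorem decWt_symm (n : ℕ) (R : Finset (Fin (d + 1) → ℤ)) (x y : ↥R) : decWt n R x y = decWt n R y x := by
  unfold decWt
  congr 1
  by_cases h : y.1 ∈ nbrs x.1 ∧ blk n y.1 = blk n x.1
  · rw [if_pos h, if_pos ⟨nbrs_comm.1 h.1, h.2.symm⟩]
  · rw [if_neg h, if_neg (fun h' => h ⟨nbrs_comm.1 h'.1, h'.2.symm⟩)]

/-- a non-zero decoupled weight means: nearest neighbours in the same unit block. [folklore] -/
theorem decWt_ne_zero {n : ℕ} {R : Finset (Fin (d + 1) → ℤ)} {x y : ↥R} (h : decWt n R x y ≠ 0) :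
    y.1 ∈ nbrs x.1 ∧ blk n y.1 = blk n x.1 := by
  unfold decWt at h
  by_contra hc
  exact h (by rw [if_neg hc, mul_zero])

/-- the block-sum weights are non-negative. [folklore] -/
theorem rBlkWt_nonneg (n : ℕ) (Ωc R : Finset (Fin (d + 1) → ℤ)) (y : ↥Ωc) (x : ↥R) : 0 ≤ rBlkWt n Ωc R y x := by
  unfold rBlkWt; split_ifs <;> norm_num

/-- a non-zero block weight means `x ∈ B(y)`. [folklore] -/
theorem rBlkWt_ne_zero {n : ℕ} {Ωc R : Finset (Fin (d + 1) → ℤ)} {y : ↥Ωc} {x : ↥R} (h : rBlkWt n Ωc R y x ≠ 0) :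
    blk n x.1 = y.1 := by
  unfold rBlkWt at h
  by_contra hb
  exact h (if_neg hb)

/-- at most `2(d+1)` neighbours. [folklore] -/
theorem card_filter_nbrs_le (R : Finset (Fin (d + 1) → ℤ)) (x : ↥R) :
    ((Finset.univ.filter fun y : ↥R => y.1 ∈ nbrs x.1).card : ℝ) ≤ 2 * (d + 1) := by
  have h : (Finset.univ.filter fun y : ↥R => y.1 ∈ nbrs x.1).card ≤ (nbrs x.1).card := by
    refine Finset.card_le_card_of_injOn Subtype.val (fun y hy => ?_) (Set.injOn_of_injective Subtype.val_injective)
    exact (Finset.mem_filter.1 (Finset.mem_coe.1 hy)).2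
  rw [card_nbrs] at h
  exact_mod_cast h

/-- the decoupled weights at a site sum to `≤ n²(d+1)`. [folklore] -/
theorem sum_decWt_le (n : ℕ) (R : Finset (Fin (d + 1) → ℤ)) (x : ↥R) :
    ∑ y, decWt n R x y ≤ (n : ℝ) ^ 2 / 2 * (2 * (d + 1)) := by
  calc ∑ y, decWt n R x y ≤ ∑ y, regWt n R x y := Finset.sum_le_sum fun y _ => decWt_le_regWt n R x y
    _ = (n : ℝ) ^ 2 / 2 * ((Finset.univ.filter fun y : ↥R => y.1 ∈ nbrs x.1).card : ℝ) := by
        unfold regWt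
        rw [← Finset.mul_sum, Finset.sum_boole]
    _ ≤ (n : ℝ) ^ 2 / 2 * (2 * (d + 1)) := mul_le_mul_of_nonneg_left (card_filter_nbrs_le R x) (by positivity)

/-- the row sums of the block weights: a unit block holds at most `n^{d+1}` fine points of the region. [folklore] -/
theorem sum_rBlkWt_row {n : ℕ} (hn : 1 ≤ n) (Ωc : Finset (Fin (d + 1) → ℤ)) (y : ↥Ωc) :
    ∑ x, rBlkWt n Ωc (fineDom n Ωc) y x ≤ (n : ℝ) ^ (d + 1) := by
  unfold rBlkWt
  rw [Finset.sum_boole]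
  by_cases h : ∃ x : ↥(fineDom n Ωc), blk n x.1 = y.1
  · obtain ⟨x₀, hx₀⟩ := h
    have hy : y.1 ∈ (fineDom n Ωc).image (blk n) := Finset.mem_image.2 ⟨x₀.1, x₀.2, hx₀⟩
    have heq : (Finset.univ.filter fun x : ↥(fineDom n Ωc) => blk n x.1 = y.1)
        = Finset.univ.filter fun x => rblk n (fineDom n Ωc) x = ⟨y.1, hy⟩ := by
      ext x
      simp only [Finset.mem_filter, Finset.mem_univ, true_and, rblk, Subtype.ext_iff]
    rw [heq, card_filter_rblk hn (fineDom_isBlockUnion hn Ωc)]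
    push_cast
    exact le_rfl
  · have heq : (Finset.univ.filter fun x : ↥(fineDom n Ωc) => blk n x.1 = y.1) = ∅ := by
      ext x
      simp only [Finset.mem_filter, Finset.mem_univ, true_and, Finset.notMem_empty, iff_false]
      exact fun hx => h ⟨x, hx⟩
    rw [heq, Finset.card_empty, Nat.cast_zero]
    positivity

/-- the column sums of the block weights: every fine point lies in at most one unit block. [folklore] -/
theorem sum_rBlkWt_col (n : ℕ) (Ωc R : Finset (Fin (d + 1) → ℤ)) (x : ↥R) : ∑ y, rBlkWt n Ωc R y x ≤ 1 := by
  unfold rBlkWt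
  rw [Finset.sum_coe_sort (s := Ωc) (f := fun w => if blk n x.1 = w then (1 : ℝ) else 0), Finset.sum_ite_eq]
  split_ifs <;> norm_num

/-! ## §3 THE ZERO-FIELD BOUND FOR THE DECOUPLED OPERATOR: `Σ_Δ (n²(−Δ^N_Δ) + a n^{-(d+1)} 1_Δ ⊗ 1_Δ) ≥ min(2,a)`

[B4] p. 580 (2.27) «⟨φ, (−Δ^{η,N}_Δ + a_kP_k)φ⟩ ≥ min{π², a_k}‖φ‖_{L²(Δ)}» per unit cube; here with the
lineage's constant `min(2, a)` (Poincaré on each block, `Beta.BlockPoincare.coercive_lap_blocks`, exactly as in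
`B4Lower18.lower18_zero` but with the INTRA-BLOCK bonds only). -/

/-- the INTRA-BLOCK BONDS of a region. [folklore] -/
abbrev IBond (n : ℕ) (R : Finset (Fin (d + 1) → ℤ)) : Type :=
  {k : RBond R // blk n (rtgt k).1 = blk n (rsrc k).1}

/-- the entries of the decoupled zero-field operator: the weighted graph Laplacian of the intra-block coupling
`n²·[y ~ x, same block]` + `Σ_Δ (a/|Δ|)·1_Δ ⊗ 1_Δ` — the shape of `Beta.BlockPoincare.coercive_lap_blocks`. [folklore] -/
theorem scalarOp_dec_apply {n : ℕ} (hn : 1 ≤ n) (a : ℝ) (Ωc : Finset (Fin (d + 1) → ℤ))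
    (j k : ↥(fineDom n Ωc)) :
    scalarOp (decWt n (fineDom n Ωc)) 0 (a * ((n : ℝ) ^ (d + 1))⁻¹) (rBlkWt n Ωc (fineDom n Ωc)) j k
      = lap (fun x y => 2 * decWt n (fineDom n Ωc) x y) j k
        + ∑ b, a / ((Finset.univ.filter fun i => rblk n (fineDom n Ωc) i = b).card : ℝ)
            * ((if rblk n (fineDom n Ωc) j = b then (1 : ℝ) else 0)
              * (if rblk n (fineDom n Ωc) k = b then (1 : ℝ) else 0)) := by
  have hR : IsBlockUnion n (fineDom n Ωc) := fineDom_isBlockUnion hn Ωc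
  have hcard : ∀ b : ↥((fineDom n Ωc).image (blk n)),
      ((Finset.univ.filter fun i => rblk n (fineDom n Ωc) i = b).card : ℝ) = (n : ℝ) ^ (d + 1) := by
    intro b
    rw [card_filter_rblk hn hR b]
    push_cast
    rfl
  simp only [hcard]
  rw [sum_ind_mul_ind, lap_apply]
  have hj : blk n j.1 ∈ Ωc := (mem_fineDom hn).1 j.2
  have hblk : ∑ y : ↥Ωc, rBlkWt n Ωc (fineDom n Ωc) y j * rBlkWt n Ωc (fineDom n Ωc) y k
      = if blk n k.1 = blk n j.1 then 1 else 0 := by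
    unfold rBlkWt
    rw [Finset.sum_coe_sort (s := Ωc)
      (f := fun w => (if blk n j.1 = w then (1 : ℝ) else 0) * (if blk n k.1 = w then (1 : ℝ) else 0)),
      Finset.sum_eq_single (blk n j.1)]
    · rw [if_pos rfl, one_mul]
    · intro w _ hw
      rw [if_neg (Ne.symm hw), zero_mul]
    · intro h
      exact absurd hj h
  have hrblk : (rblk n (fineDom n Ωc) k = rblk n (fineDom n Ωc) j) ↔ (blk n k.1 = blk n j.1) := by
    simp only [rblk, Subtype.mk.injEq]
  have hsum : ∑ x, decWt n (fineDom n Ωc) x j = ∑ y, decWt n (fineDom n Ωc) j y :=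
    Finset.sum_congr rfl fun x _ => decWt_symm n _ x j
  simp only [scalarOp, Matrix.of_apply, hblk, hrblk]
  rw [hsum, decWt_symm n _ k j, ← Finset.mul_sum]
  by_cases hjk : j = k
  · subst hjk
    simp only [if_true, mul_one]
    ring
  · rw [if_neg hjk, if_neg hjk, if_neg hjk]
    split_ifs <;> ring

/-- **THE DECOUPLED ZERO-FIELD BOUND**: on the fine region over any finite set of unit labels, for every mesh and
every `a ≥ 0`, `⟨g, Σ_Δ(n²(−Δ^N_Δ) + a n^{-(d+1)}1_Δ ⊗ 1_Δ)g⟩ ≥ min(2,a)‖g‖²` ([B4] (2.27) with the lineage's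
constant). [cite: Balaban1983RegularityDecay, p. 580 (2.26)–(2.27), case A = 0] -/
theorem lower18_zero_dec {n : ℕ} (hn : 1 ≤ n) {a : ℝ} (ha : 0 ≤ a) (Ωc : Finset (Fin (d + 1) → ℤ))
    (g : ↥(fineDom n Ωc) → ℝ) :
    min 2 a * (g ⬝ᵥ g)
      ≤ g ⬝ᵥ (scalarOp (decWt n (fineDom n Ωc)) 0 (a * ((n : ℝ) ^ (d + 1))⁻¹) (rBlkWt n Ωc (fineDom n Ωc))
          *ᵥ g) := by
  classical
  have hR : IsBlockUnion n (fineDom n Ωc) := fineDom_isBlockUnion hn Ωc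
  have hn0 : (0 : ℝ) < n := by exact_mod_cast hn
  -- Poincaré on every block w.r.t. all bonds of the region inside the block (as in `B4Lower18.lower18_zero`)
  have hPoin0 : ∀ (b : ↥((fineDom n Ωc).image (blk n))) (f : ↥(fineDom n Ωc) → ℝ),
      ∑ i ∈ Finset.univ.filter (fun i => rblk n (fineDom n Ωc) i = b),
          (f i - avg (Finset.univ.filter fun i => rblk n (fineDom n Ωc) i = b) f) ^ 2
        ≤ (n : ℝ) ^ 2 / 2 *
          ∑ k ∈ Finset.univ.filter (fun k : RBond (fineDom n Ωc) =>
              rblk n (fineDom n Ωc) (rsrc k) = b ∧ rblk n (fineDom n Ωc) (rtgt k) = b),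
            (f (rtgt k) - f (rsrc k)) ^ 2 := by
    obtain ⟨ℓ, rfl⟩ : ∃ ℓ, n = ℓ + 1 := ⟨n - 1, by omega⟩
    intro b f
    have hnonneg : 0 ≤ ∑ k ∈ Finset.univ.filter
        (fun k : RBond (fineDom (ℓ + 1) Ωc) =>
          rblk (ℓ + 1) (fineDom (ℓ + 1) Ωc) (rsrc k) = b ∧ rblk (ℓ + 1) (fineDom (ℓ + 1) Ωc) (rtgt k) = b),
          (f (rtgt k) - f (rsrc k)) ^ 2 := Finset.sum_nonneg fun _ _ => sq_nonneg _
    rcases Nat.eq_zero_or_pos ℓ with rfl | hℓ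
    · rw [rblock_var_eq_zero_one hR b f]
      positivity
    · refine (rblock_poincare hℓ hR b f).trans (mul_le_mul_of_nonneg_right ?_ hnonneg)
      push_cast
      have hl : (0 : ℝ) ≤ ℓ := Nat.cast_nonneg ℓ
      nlinarith [hl]
  -- the same w.r.t. the intra-block bond type
  have hPoin : ∀ (b : ↥((fineDom n Ωc).image (blk n))) (f : ↥(fineDom n Ωc) → ℝ),
      ∑ i ∈ Finset.univ.filter (fun i => rblk n (fineDom n Ωc) i = b),
          (f i - avg (Finset.univ.filter fun i => rblk n (fineDom n Ωc) i = b) f) ^ 2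
        ≤ (n : ℝ) ^ 2 / 2 *
          ∑ k ∈ Finset.univ.filter (fun k : IBond n (fineDom n Ωc) =>
              rblk n (fineDom n Ωc) (rsrc k.1) = b ∧ rblk n (fineDom n Ωc) (rtgt k.1) = b),
            (f (rtgt k.1) - f (rsrc k.1)) ^ 2 := by
    intro b f
    refine (hPoin0 b f).trans (le_of_eq ?_)
    congr 1
    rw [Finset.sum_filter, Finset.sum_filter,
      ← Finset.sum_subtype (p := fun k : RBond (fineDom n Ωc) => blk n (rtgt k).1 = blk n (rsrc k).1)
        (Finset.univ.filter fun k : RBond (fineDom n Ωc) => blk n (rtgt k).1 = blk n (rsrc k).1) (by simp)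
        (fun k => if rblk n (fineDom n Ωc) (rsrc k) = b ∧ rblk n (fineDom n Ωc) (rtgt k) = b
          then (f (rtgt k) - f (rsrc k)) ^ 2 else 0),
      Finset.sum_filter]
    refine Finset.sum_congr rfl fun k _ => ?_
    by_cases hk : rblk n (fineDom n Ωc) (rsrc k) = b ∧ rblk n (fineDom n Ωc) (rtgt k) = b
    · have hs : blk n (rtgt k).1 = blk n (rsrc k).1 := by
        have h1 := congrArg Subtype.val hk.1
        have h2 := congrArg Subtype.val hk.2
        simp only [rblk] at h1 h2
        rw [h1, h2]
      rw [if_pos hs, if_pos hk]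
    · rw [if_neg hk]
      split_ifs <;> rfl
  have hcs : ∀ x y : ↥(fineDom n Ωc), 2 * decWt n (fineDom n Ωc) x y = 2 * decWt n (fineDom n Ωc) y x :=
    fun x y => by rw [decWt_symm]
  have hc0 : ∀ x y : ↥(fineDom n Ωc), 0 ≤ 2 * decWt n (fineDom n Ωc) x y :=
    fun x y => mul_nonneg zero_le_two (decWt_nonneg n _ x y)
  have hγ : ∀ k : IBond n (fineDom n Ωc), (n : ℝ) ^ 2 ≤ 2 * decWt n (fineDom n Ωc) (rsrc k.1) (rtgt k.1) := by
    intro k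
    have hnb : (rtgt k.1).1 ∈ nbrs (rsrc k.1).1 := mem_nbrs.2 ⟨k.1.1.2, Or.inl rfl⟩
    unfold decWt
    rw [if_pos ⟨hnb, k.2⟩]
    linarith
  have hinj : Function.Injective fun k : IBond n (fineDom n Ωc) => (rsrc k.1, rtgt k.1) :=
    fun k k' h => Subtype.ext (rbond_injective (fineDom n Ωc) h)
  have hanti : ∀ k k' : IBond n (fineDom n Ωc), (rsrc k.1, rtgt k.1) ≠ (rtgt k'.1, rsrc k'.1) :=
    fun k k' => rbond_anti (fineDom n Ωc) k.1 k'.1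
  have h := coercive_lap_blocks (fun x y => 2 * decWt n (fineDom n Ωc) x y) hcs hc0 (rblk n (fineDom n Ωc))
    (fun k : IBond n (fineDom n Ωc) => rsrc k.1) (fun k => rtgt k.1) ((n : ℝ) ^ 2) a ((n : ℝ) ^ 2 / 2)
    (by positivity) ha (by positivity) hγ hinj hanti hPoin
    (scalarOp (decWt n (fineDom n Ωc)) 0 (a * ((n : ℝ) ^ (d + 1))⁻¹) (rBlkWt n Ωc (fineDom n Ωc)))
    (scalarOp_dec_apply hn a Ωc) g
  have hγP : (n : ℝ) ^ 2 / ((n : ℝ) ^ 2 / 2) = 2 := by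
    field_simp
  rwa [hγP] at h


/-! ## §4 BLOCKWISE-CONSTANT BACKGROUNDS: the decoupled operator at `A₀(Δ)` is a gauge transform of the zero-field one

[B4] p. 580: «Using the same gauge transformation as in the proof of Lemma 2.4, we reduce them to the case A₀ = 0»;
after the decoupling (2.26) every unit cube `Δ` may carry ITS OWN constant `A₀(Δ)`: the gauge
`g(x) = U(−κ⟨A₀(Δ(x)), x⟩)` conjugates the intra-block link variables and the block transporters to the identity. -/

/-- A BLOCKWISE-CONSTANT CONFIGURATION on a region: on the pair `(u, v)` the constant field `A₀(Δ(u))` of the unit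
cube of `u`, `A₀(Δ)(u,v) = ⟨A₀(Δ(u)), v − u⟩` (used only on intra-block pairs). [cite: Balaban1983RegularityDecay,
p. 579 (2.23) «A = A₀ + A'» per cube, dictionary] -/
def blockConst (n : ℕ) (R : Finset (Fin (d + 1) → ℤ)) (A₀c : (Fin (d + 1) → ℤ) → Fin (d + 1) → ℝ) :
    ↥R → ↥R → ℝ :=
  fun u v => constBond (A₀c (blk n u.1)) Subtype.val u v

/-- THE BLOCK GAUGE `g(x) = U(κλ_{Δ(x)}(x))`, `λ_Δ = −⟨A₀(Δ), ·⟩`. [folklore] -/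
def blockGaugeFn {ι : Type*} [Fintype ι] [DecidableEq ι] (F : OrthFlow ι) (κ : ℝ) (n : ℕ)
    (R : Finset (Fin (d + 1) → ℤ)) (A₀c : (Fin (d + 1) → ℤ) → Fin (d + 1) → ℝ) : ↥R → Matrix ι ι ℝ :=
  fun u => F.U (κ * linGauge (A₀c (blk n u.1)) Subtype.val u)

/-- the block gauge is orthogonal at every site. [folklore] -/
theorem blockGaugeFn_isGauge {ι : Type*} [Fintype ι] [DecidableEq ι] (F : OrthFlow ι) (κ : ℝ) (n : ℕ)
    (R : Finset (Fin (d + 1) → ℤ)) (A₀c : (Fin (d + 1) → ℤ) → Fin (d + 1) → ℝ) :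
    IsGauge (blockGaugeFn F κ n R A₀c) :=
  fun _ => F.orth _

/-- **ON AN INTRA-BLOCK PAIR THE LINK VARIABLE OF `A₀(Δ)` IS GAUGE-TRIVIAL**: `U(κA₀(Δ)(u,v)) = g(u)·1·g(v)ᵀ`.
[folklore] -/
theorem fieldLink_blockConst_same {ι : Type*} [Fintype ι] [DecidableEq ι] (F : OrthFlow ι) (κ : ℝ) (n : ℕ)
    (R : Finset (Fin (d + 1) → ℤ)) (A₀c : (Fin (d + 1) → ℤ) → Fin (d + 1) → ℝ) {u v : ↥R}
    (h : blk n v.1 = blk n u.1) :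
    fieldLink F κ (blockConst n R A₀c) u v
      = gaugeKer (blockGaugeFn F κ n R A₀c) (blockGaugeFn F κ n R A₀c) (fun _ _ => (1 : Matrix ι ι ℝ)) u v := by
  have key := congrFun (congrFun (fieldLink_constBond F κ (A₀c (blk n u.1)) (Subtype.val : ↥R → _)) u) v
  simp only [gaugeKer_apply, fieldLink, blockConst, blockGaugeFn] at key ⊢
  rw [h]
  exact key

/-- the block transporters of `A₀(Δ)` along contours INSIDE the block are gauge transforms of the identity. [folklore] -/
theorem contourTrans_blockConst {ι : Type*} [Fintype ι] [DecidableEq ι] (F : OrthFlow ι) (κ : ℝ) (n : ℕ)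
    (Ωc R : Finset (Fin (d + 1) → ℤ)) (A₀c : (Fin (d + 1) → ℤ) → Fin (d + 1) → ℝ) {emb : ↥Ωc → ↥R}
    {Γ : ↥Ωc → ↥R → List ↥R} (hemb : ∀ y x, rBlkWt n Ωc R y x ≠ 0 → blk n (emb y).1 = y.1)
    (hpath : ∀ y x, rBlkWt n Ωc R y x ≠ 0 →
      PathRel (fun u v : ↥R => v.1 ∈ nbrs u.1 ∧ blk n v.1 = y.1) (emb y) (Γ y x))
    (y : ↥Ωc) (x : ↥R) (hq : rBlkWt n Ωc R y x ≠ 0) :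
    contourTrans (fieldLink F κ (blockConst n R A₀c)) emb Γ y x
      = contourTrans (gaugeKer (blockGaugeFn F κ n R A₀c) (blockGaugeFn F κ n R A₀c)
          (fun _ _ => (1 : Matrix ι ι ℝ))) emb Γ y x := by
  unfold contourTrans
  refine transport_congr (r := fun u v : ↥R => blk n u.1 = y.1 ∧ (v.1 ∈ nbrs u.1 ∧ blk n v.1 = y.1)) ?_ _ _
    (pathRel_chain (r := fun u v : ↥R => v.1 ∈ nbrs u.1) (P := fun u : ↥R => blk n u.1 = y.1) _ _
      (hemb y x hq) (hpath y x hq))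
  intro u v huv
  exact fieldLink_blockConst_same F κ n R A₀c (huv.2.2.trans huv.1.symm)

/-- **THE DECOUPLED OPERATOR AT A BLOCKWISE-CONSTANT CONFIGURATION IS A GAUGE TRANSFORM OF THE ZERO-FIELD ONE**:
`Σ_Δ H_Δ(A₀(Δ)) = 𝒢 ((Σ_Δ H_Δ(0)) ⊗ 1_N) 𝒢ᵀ`, `𝒢 = ⊕_x g(x)` ([B4] p. 580 «we reduce them to the case A₀ = 0», cube by
cube). [cite: Balaban1983RegularityDecay, pp. 580–581] -/
theorem b4Op_blockConst_dec {ι : Type*} [Fintype ι] [DecidableEq ι] (F : OrthFlow ι) (κ : ℝ) (n : ℕ)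
    (Ωc R : Finset (Fin (d + 1) → ℤ)) (m2 a : ℝ) (A₀c : (Fin (d + 1) → ℤ) → Fin (d + 1) → ℝ)
    {emb : ↥Ωc → ↥R} {Γ : ↥Ωc → ↥R → List ↥R} (hemb : ∀ y x, rBlkWt n Ωc R y x ≠ 0 → blk n (emb y).1 = y.1)
    (hend : ∀ y x, rBlkWt n Ωc R y x ≠ 0 → pathEnd (emb y) (Γ y x) = x)
    (hpath : ∀ y x, rBlkWt n Ωc R y x ≠ 0 →
      PathRel (fun u v : ↥R => v.1 ∈ nbrs u.1 ∧ blk n v.1 = y.1) (emb y) (Γ y x)) :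
    b4Op F κ (decWt n R) m2 a (rBlkWt n Ωc R) emb Γ (blockConst n R A₀c)
      = blockDiag (blockGaugeFn F κ n R A₀c) * (scalarOp (decWt n R) m2 a (rBlkWt n Ωc R) ⊗ₖ (1 : Matrix ι ι ℝ))
          * (blockDiag (blockGaugeFn F κ n R A₀c))ᵀ := by
  have hW : ∀ u v : ↥R, decWt n R u v ≠ 0 → fieldLink F κ (blockConst n R A₀c) u v
      = gaugeKer (blockGaugeFn F κ n R A₀c) (blockGaugeFn F κ n R A₀c) (fun _ _ => (1 : Matrix ι ι ℝ)) u v :=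
    fun u v h => fieldLink_blockConst_same F κ n R A₀c (decWt_ne_zero h).2
  have hT1 : contourTrans (fun _ _ : ↥R => (1 : Matrix ι ι ℝ)) emb Γ = fun _ _ => 1 := by
    funext y x
    exact transport_one _ _
  rw [b4Op, covOp_congr m2 a hW (contourTrans_blockConst F κ n Ωc R A₀c hemb hpath),
    covOp_contour_gauge (blockGaugeFn_isGauge F κ n R A₀c) (decWt n R) m2 a hend, hT1, covOp_trivial]

/-- **THE BACKGROUND BOUND ON A REGION**: `⟨Φ, Σ_Δ(−Δ_{A₀(Δ),Δ} + a n^{-(d+1)}P_Δ(A₀(Δ)))Φ⟩ ≥ min(2,a)|Φ|²` for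
every blockwise-constant configuration and every contour system whose weighted contours stay in their block and end at
the target. [cite: Balaban1983RegularityDecay, p. 580 (2.26)–(2.27) with p. 581] -/
theorem background_form_ge_region {ι : Type*} [Fintype ι] [DecidableEq ι] (F : OrthFlow ι) (κ : ℝ) {n : ℕ}
    (hn : 1 ≤ n) {a : ℝ} (ha : 0 ≤ a) (Ωc : Finset (Fin (d + 1) → ℤ))
    (A₀c : (Fin (d + 1) → ℤ) → Fin (d + 1) → ℝ) {emb : ↥Ωc → ↥(fineDom n Ωc)}
    {Γ : ↥Ωc → ↥(fineDom n Ωc) → List ↥(fineDom n Ωc)}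
    (hemb : ∀ y x, rBlkWt n Ωc (fineDom n Ωc) y x ≠ 0 → blk n (emb y).1 = y.1)
    (hend : ∀ y x, rBlkWt n Ωc (fineDom n Ωc) y x ≠ 0 → pathEnd (emb y) (Γ y x) = x)
    (hpath : ∀ y x, rBlkWt n Ωc (fineDom n Ωc) y x ≠ 0 →
      PathRel (fun u v : ↥(fineDom n Ωc) => v.1 ∈ nbrs u.1 ∧ blk n v.1 = y.1) (emb y) (Γ y x))
    (Φ : ↥(fineDom n Ωc) × ι → ℝ) :
    min 2 a * (Φ ⬝ᵥ Φ)
      ≤ Φ ⬝ᵥ (covLap (decWt n (fineDom n Ωc)) (fieldLink F κ (blockConst n (fineDom n Ωc) A₀c)) *ᵥ Φ)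
        + a * ((n : ℝ) ^ (d + 1))⁻¹
          * (Φ ⬝ᵥ (projOp (rBlkWt n Ωc (fineDom n Ωc))
              (contourTrans (fieldLink F κ (blockConst n (fineDom n Ωc) A₀c)) emb Γ) *ᵥ Φ)) := by
  have hH : Φ ⬝ᵥ (covLap (decWt n (fineDom n Ωc)) (fieldLink F κ (blockConst n (fineDom n Ωc) A₀c)) *ᵥ Φ)
        + a * ((n : ℝ) ^ (d + 1))⁻¹
          * (Φ ⬝ᵥ (projOp (rBlkWt n Ωc (fineDom n Ωc))
              (contourTrans (fieldLink F κ (blockConst n (fineDom n Ωc) A₀c)) emb Γ) *ᵥ Φ))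
      = Φ ⬝ᵥ (b4Op F κ (decWt n (fineDom n Ωc)) 0 (a * ((n : ℝ) ^ (d + 1))⁻¹) (rBlkWt n Ωc (fineDom n Ωc))
          emb Γ (blockConst n (fineDom n Ωc) A₀c) *ᵥ Φ) := by
    rw [b4Op, covOp_form, zero_mul, add_zero]
  rw [hH, b4Op_blockConst_dec F κ n Ωc _ 0 _ A₀c hemb hend hpath]
  set G := blockDiag (blockGaugeFn F κ n (fineDom n Ωc) A₀c) with hG
  have hg : IsGauge (blockGaugeFn F κ n (fineDom n Ωc) A₀c) := blockGaugeFn_isGauge F κ n _ A₀c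
  rw [← Matrix.mulVec_mulVec, ← Matrix.mulVec_mulVec, Matrix.dotProduct_mulVec, ← Matrix.mulVec_transpose,
    kron_one_form, ← gauge_transpose_dotProduct_self hg Φ, ← hG, dotProduct_eq_sum_colour (Gᵀ *ᵥ Φ),
    Finset.mul_sum]
  exact Finset.sum_le_sum fun i _ => lower18_zero_dec hn ha Ωc _

/-! ## §5 (1.8) FOR REGULAR NON-CONSTANT CONFIGURATIONS ON REGIONS THAT ARE UNIONS OF UNIT BLOCKS

[B4] p. 572 «We consider subsets Ω which are unions of big blocks.»; p. 573 «The constant γ₀ is independent of the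
lattice spacing η, as well as of Ω and of A.»  Mechanism: (2.26) decoupling into unit cubes, per cube the expansion
(2.23)–(2.24) about the cube's own constant background, Cauchy–Schwarz with weight `1/2`
(`B4Lower18Regular.covOp_kmul_form_ge_quarter`). -/

/-- **THE SITEWISE BOUND ON `F_1` WITH THE DECOUPLED WEIGHTS**: if `|κA'_b| ≤ θ/n` on INTRA-BLOCK nearest-neighbour
bonds, `Σ_y c_dec(x,y)|E(x,y)v|² ≤ (d+1)ℓ²θ²|v|²`. [cite: Balaban1983RegularityDecay, pp. 579–580] -/
theorem pertE_site_bound_dec {ι : Type*} [Fintype ι] [DecidableEq ι] (F : OrthFlow ι) {ℓ : ℝ}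
    (hLip : ∀ t (v : ι → ℝ), ((F.U t - 1) *ᵥ v) ⬝ᵥ ((F.U t - 1) *ᵥ v) ≤ (ℓ * t) ^ 2 * (v ⬝ᵥ v))
    (κ : ℝ) {n : ℕ} (hn : 1 ≤ n) (R : Finset (Fin (d + 1) → ℤ)) {A' : ↥R → ↥R → ℝ} {θ : ℝ}
    (hA' : ∀ u v : ↥R, v.1 ∈ nbrs u.1 → blk n v.1 = blk n u.1 → |κ * A' u v| ≤ θ / n) (x : ↥R) (v : ι → ℝ) :
    ∑ y, decWt n R x y * ((pertE (fieldLink F κ A') x y *ᵥ v) ⬝ᵥ (pertE (fieldLink F κ A') x y *ᵥ v))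
      ≤ (d + 1) * ℓ ^ 2 * θ ^ 2 * (v ⬝ᵥ v) := by
  have hn0 : (0 : ℝ) < n := by exact_mod_cast hn
  have hv := dotProduct_self_nonneg' v
  have hE : ∀ y, (pertE (fieldLink F κ A') x y *ᵥ v) ⬝ᵥ (pertE (fieldLink F κ A') x y *ᵥ v)
      = ((F.U (-(κ * A' x y)) - 1) *ᵥ v) ⬝ᵥ ((F.U (-(κ * A' x y)) - 1) *ᵥ v) := by
    intro y
    simp only [pertE, fieldLink, F.transpose_eq]
    rw [← neg_sub, Matrix.neg_mulVec, neg_dotProduct, dotProduct_neg, neg_neg]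
  have hterm : ∀ y : ↥R, y.1 ∈ nbrs x.1 ∧ blk n y.1 = blk n x.1 →
      (pertE (fieldLink F κ A') x y *ᵥ v) ⬝ᵥ (pertE (fieldLink F κ A') x y *ᵥ v)
        ≤ ℓ ^ 2 * (θ / n) ^ 2 * (v ⬝ᵥ v) := by
    intro y hy
    rw [hE]
    refine (hLip _ v).trans ?_
    have h1 : (κ * A' x y) ^ 2 ≤ (θ / n) ^ 2 := by
      rw [← sq_abs]
      exact pow_le_pow_left₀ (abs_nonneg _) (hA' x y hy.1 hy.2) 2
    have h2 : (ℓ * -(κ * A' x y)) ^ 2 = ℓ ^ 2 * (κ * A' x y) ^ 2 := by ring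
    rw [h2]
    exact mul_le_mul_of_nonneg_right (mul_le_mul_of_nonneg_left h1 (sq_nonneg ℓ)) hv
  have hB : 0 ≤ ℓ ^ 2 * (θ / n) ^ 2 * (v ⬝ᵥ v) := by positivity
  calc ∑ y, decWt n R x y * ((pertE (fieldLink F κ A') x y *ᵥ v) ⬝ᵥ (pertE (fieldLink F κ A') x y *ᵥ v))
      ≤ ∑ y, decWt n R x y * (ℓ ^ 2 * (θ / n) ^ 2 * (v ⬝ᵥ v)) := by
        refine Finset.sum_le_sum fun y _ => ?_
        by_cases hy : y.1 ∈ nbrs x.1 ∧ blk n y.1 = blk n x.1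
        · exact mul_le_mul_of_nonneg_left (hterm y hy) (decWt_nonneg n R x y)
        · have h0 : decWt n R x y = 0 := by
            unfold decWt
            rw [if_neg hy, mul_zero]
          rw [h0, zero_mul, zero_mul]
    _ = (∑ y, decWt n R x y) * (ℓ ^ 2 * (θ / n) ^ 2 * (v ⬝ᵥ v)) := by rw [Finset.sum_mul]
    _ ≤ (n : ℝ) ^ 2 / 2 * (2 * (d + 1)) * (ℓ ^ 2 * (θ / n) ^ 2 * (v ⬝ᵥ v)) :=
        mul_le_mul_of_nonneg_right (sum_decWt_le n R x) hB
    _ = (d + 1) * ℓ ^ 2 * θ ^ 2 * (v ⬝ᵥ v) := by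
        field_simp

/-- **THEOREM ((1.8) FOR REGULAR NON-CONSTANT CONFIGURATIONS ON UNIONS OF UNIT BLOCKS, EXPLICIT CONSTANTS)**:
on the fine region over ANY finite set `Ωc` of unit labels (`Ω = ⋃_{y ∈ Ωc} B(y)`, `n = L^k` points per unit
length, Neumann bonds of `Ω`, `a·n^{-(d+1)}P_k`), for ANY configuration `A` whose deviation from SOME constant
`A₀(Δ)` on each unit cube satisfies `|κ(A − A₀(Δ))_b| ≤ θ/n` on the cube's nearest-neighbour bonds (the printed
(2.23) «|A'|, |∂^η_μA'| ≤ c'e^{β−1}» per cube with `κ = eη`, `θ = c'e^β`), every contour system whose weighted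
contours `Γ_{y,x}` start in, stay in and end at `x` in `B(y)` with `|Γ_{y,x}| ≤ (d+1)n`, and smallness
`ℓ²θ²(d+1)(1 + a(d+1)) ≤ min(2,a)/4`:  `⟨Φ, (−Δ^{η,N}_{A,Ω} + m² + aP_k(A))Φ⟩ ≥ (min(2,a)/4 + m²)|Φ|²` — a constant
INDEPENDENT OF `η`, `Ω` AND `A`.  HONEST LABEL: [B4]'s `γ₀` is unspecified; `min(2,a)` is the lineage's zero-field
constant. [cite: Balaban1983RegularityDecay, p. 573 (1.8) with pp. 579–580 (2.23)–(2.27)] -/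
theorem lower18_regular_region {ι : Type*} [Fintype ι] [DecidableEq ι] (F : OrthFlow ι) {ℓ : ℝ} (hℓ : 0 ≤ ℓ)
    (hLip : ∀ t (v : ι → ℝ), ((F.U t - 1) *ᵥ v) ⬝ᵥ ((F.U t - 1) *ᵥ v) ≤ (ℓ * t) ^ 2 * (v ⬝ᵥ v))
    (κ : ℝ) {n : ℕ} (hn : 1 ≤ n) {a : ℝ} (ha : 0 ≤ a) (m2 : ℝ) (Ωc : Finset (Fin (d + 1) → ℤ))
    {emb : ↥Ωc → ↥(fineDom n Ωc)} {Γ : ↥Ωc → ↥(fineDom n Ωc) → List ↥(fineDom n Ωc)}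
    (hemb : ∀ y x, rBlkWt n Ωc (fineDom n Ωc) y x ≠ 0 → blk n (emb y).1 = y.1)
    (hend : ∀ y x, rBlkWt n Ωc (fineDom n Ωc) y x ≠ 0 → pathEnd (emb y) (Γ y x) = x)
    (hpath : ∀ y x, rBlkWt n Ωc (fineDom n Ωc) y x ≠ 0 →
      PathRel (fun u v : ↥(fineDom n Ωc) => v.1 ∈ nbrs u.1 ∧ blk n v.1 = y.1) (emb y) (Γ y x))
    (hlen : ∀ y x, rBlkWt n Ωc (fineDom n Ωc) y x ≠ 0 → ((Γ y x).length : ℝ) ≤ (d + 1) * n)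
    (A₀c : (Fin (d + 1) → ℤ) → Fin (d + 1) → ℝ) {A : ↥(fineDom n Ωc) → ↥(fineDom n Ωc) → ℝ} {θ : ℝ}
    (hθ : 0 ≤ θ)
    (hA : ∀ u v : ↥(fineDom n Ωc), v.1 ∈ nbrs u.1 → blk n v.1 = blk n u.1 →
      |κ * (A u v - blockConst n (fineDom n Ωc) A₀c u v)| ≤ θ / n)
    (hsmall : ℓ ^ 2 * θ ^ 2 * (d + 1) * (1 + a * (d + 1)) ≤ min 2 a / 4)
    (Φ : ↥(fineDom n Ωc) × ι → ℝ) :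
    (min 2 a / 4 + m2) * (Φ ⬝ᵥ Φ)
      ≤ Φ ⬝ᵥ (b4Op F κ (regWt n (fineDom n Ωc)) m2 (a * ((n : ℝ) ^ (d + 1))⁻¹) (rBlkWt n Ωc (fineDom n Ωc))
          emb Γ A *ᵥ Φ) := by
  have hn0 : (0 : ℝ) < n := by exact_mod_cast hn
  have hnd : (0 : ℝ) < (n : ℝ) ^ (d + 1) := pow_pos hn0 _
  rw [b4Op]
  refine le_trans ?_ (covOp_form_mono (fun x y => decWt_le_regWt n (fineDom n Ωc) x y) m2 _ _ _ _ Φ)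
  have hsplit : A = blockConst n (fineDom n Ωc) A₀c + (A - blockConst n (fineDom n Ωc) A₀c) :=
    (add_sub_cancel _ _).symm
  have hcomm : ∀ p q u v : ↥(fineDom n Ωc),
      fieldLink F κ (blockConst n (fineDom n Ωc) A₀c) p q * fieldLink F κ (A - blockConst n (fineDom n Ωc) A₀c) u v
        = fieldLink F κ (A - blockConst n (fineDom n Ωc) A₀c) u v
            * fieldLink F κ (blockConst n (fineDom n Ωc) A₀c) p q :=
    fun p q u v => F.comm _ _
  rw [hsplit, fieldLink_add, contourTrans_kmul hcomm]
  refine covOp_kmul_form_ge_quarter (fun x y => decWt_nonneg n _ x y) m2 (mul_nonneg ha (inv_nonneg.2 hnd.le)) _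
    (fieldLink_orth F κ _) _ _ _ (γ₀ := min 2 a) (ε₁ := (d + 1) * ℓ ^ 2 * θ ^ 2)
    (ε₂ := (n : ℝ) ^ (d + 1) * 1 * (ℓ * ((d + 1) * θ)) ^ 2)
    (background_form_ge_region F κ hn ha Ωc A₀c hemb hend hpath) ?_ ?_ ?_ Φ
  · exact pertE_form_le (pertE_site_bound_dec F hLip κ hn _ hA)
  · intro Ψ
    refine pertF_form_le (fun y x => rBlkWt_nonneg n Ωc _ y x) hnd.le (by positivity) (sum_rBlkWt_row hn Ωc)
      (sum_rBlkWt_col n Ωc _) ?_ ?_ Ψ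
    · intro y x
      rw [contourTrans, transport_fieldLink]
      exact F.orth _
    · intro y x v hyx
      exact pertT_bound_gen F hℓ hLip κ hn hθ
        (r := fun u v : ↥(fineDom n Ωc) => blk n u.1 = y.1 ∧ (v.1 ∈ nbrs u.1 ∧ blk n v.1 = y.1))
        (fun u v huv => hA u v huv.2.1 (huv.2.2.trans huv.1.symm))
        (pathRel_chain (r := fun u v : ↥(fineDom n Ωc) => v.1 ∈ nbrs u.1) (P := fun u => blk n u.1 = y.1) _ _
          (hemb y x hyx) (hpath y x hyx)) (hlen y x hyx) v
  · have : (d + 1) * ℓ ^ 2 * θ ^ 2 + a * ((n : ℝ) ^ (d + 1))⁻¹ * ((n : ℝ) ^ (d + 1) * 1 * (ℓ * ((d + 1) * θ)) ^ 2)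
        = ℓ ^ 2 * θ ^ 2 * (d + 1) * (1 + a * (d + 1)) := by
      field_simp
    rw [this]
    exact hsmall

end Region


section Contour

/-! ## §6 THE STAIRCASE CONTOUR SYSTEM OF A REGION (the oriented contours `Γ^{(k)}_{y,x}` in `B^k(y)` from `y` to `x`,
p. 572, transcript paraphrase)
and (1.8) on regions with the contour hypotheses discharged -/

open Literature.MathematicalPhysics.QuantumFieldTheory.Balaban1983to89.B4Reflection242
  (nbrs blk mem_nbrs nbrs_comm card_nbrs blk_mul)
open Literature.MathematicalPhysics.QuantumFieldTheory.Balaban1983to89.B4Lower18 (fineDom mem_fineDom)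

variable {d : ℕ}

/-- block geometry: a point between the base corner of `B(y)` and a point of `B(y)` lies in `B(y)`. [folklore] -/
theorem blk_of_between {n : ℕ} (hn : 1 ≤ n) {x y z : Fin (d + 1) → ℤ} (hx : blk n x = y)
    (h1 : (fun i => (n : ℤ) * y i) ≤ z) (h2 : z ≤ x) : blk n z = y := by
  funext i
  have hn0 : (0 : ℤ) < n := by exact_mod_cast hn
  have hxi : x i / (n : ℤ) = y i := by rw [← hx]; rfl
  have hdiv := Int.mul_ediv_add_emod (x i) (n : ℤ)
  have hr1 := Int.emod_lt_of_pos (x i) hn0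
  have h1i : (n : ℤ) * y i ≤ z i := h1 i
  have h2i : z i ≤ x i := h2 i
  rw [hxi] at hdiv
  show z i / (n : ℤ) = y i
  apply le_antisymm
  · exact Int.lt_add_one_iff.1 ((Int.ediv_lt_iff_lt_mul hn0).2 (by linarith))
  · exact (Int.le_ediv_iff_mul_le hn0).2 (by linarith)

/-- the base corner `n·y` of a unit block of the region lies in the fine region. [folklore] -/
theorem base_mem_fineDom {n : ℕ} (hn : 1 ≤ n) (Ωc : Finset (Fin (d + 1) → ℤ)) (y : ↥Ωc) :
    (fun i => (n : ℤ) * y.1 i) ∈ fineDom n Ωc := by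
  rw [mem_fineDom hn, blk_mul hn]
  exact y.2

/-- the base-corner embedding `y ↦ n·y` of the unit labels into the fine region. [folklore] -/
def rbaseEmb {n : ℕ} (hn : 1 ≤ n) (Ωc : Finset (Fin (d + 1) → ℤ)) (y : ↥Ωc) : ↥(fineDom n Ωc) :=
  ⟨fun i => (n : ℤ) * y.1 i, base_mem_fineDom hn Ωc y⟩

/-- the staircase from the base corner of `B(y)` to `x ∈ B(y)` stays inside `B(y) ⊂ Ω`. [folklore] -/
theorem stair_mem_fineDom {n : ℕ} (hn : 1 ≤ n) (Ωc : Finset (Fin (d + 1) → ℤ)) (y : ↥Ωc) (x : ↥(fineDom n Ωc))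
    (h : blk n x.1 = y.1) : ∀ z ∈ stair (fun i => (n : ℤ) * y.1 i) x.1, z ∈ fineDom n Ωc := fun z hz => by
  rw [mem_fineDom hn, blk_of_between hn h (mem_stair (base_le_of_blk hn h).1 hz).1
    (mem_stair (base_le_of_blk hn h).1 hz).2]
  exact y.2

open Classical in
/-- **THE CONTOUR SYSTEM `Γ_{y,x}` OF A REGION**: the staircase inside `B(y)` when `x ∈ B(y)`, empty otherwise.
[cite: Balaban1983RegularityDecay, p. 572 «Γ^{(k)}_{y,x}»] -/
noncomputable def rstairContour {n : ℕ} (hn : 1 ≤ n) (Ωc : Finset (Fin (d + 1) → ℤ)) (y : ↥Ωc)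
    (x : ↥(fineDom n Ωc)) : List ↥(fineDom n Ωc) :=
  if h : blk n x.1 = y.1 then
    (stair (fun i => (n : ℤ) * y.1 i) x.1).pmap Subtype.mk (stair_mem_fineDom hn Ωc y x h)
  else []

/-- hypothesis `hemb`: the contours start in their block. [folklore] -/
theorem rbaseEmb_blk {n : ℕ} (hn : 1 ≤ n) (Ωc : Finset (Fin (d + 1) → ℤ)) (y : ↥Ωc) :
    blk n (rbaseEmb hn Ωc y).1 = y.1 :=
  blk_mul hn y.1

/-- hypothesis `hend`: the weighted contours end at the target. [folklore] -/
theorem rstairContour_end {n : ℕ} (hn : 1 ≤ n) (Ωc : Finset (Fin (d + 1) → ℤ)) (y : ↥Ωc) (x : ↥(fineDom n Ωc))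
    (h : rBlkWt n Ωc (fineDom n Ωc) y x ≠ 0) : pathEnd (rbaseEmb hn Ωc y) (rstairContour hn Ωc y x) = x := by
  have hb := rBlkWt_ne_zero h
  rw [rstairContour, dif_pos hb]
  apply Subtype.ext
  rw [rbaseEmb, val_pathEnd_pmap]
  exact pathEnd_stair (base_le_of_blk hn hb).1

/-- hypothesis `hpath`: nearest-neighbour steps inside the block. [folklore] -/
theorem rstairContour_path {n : ℕ} (hn : 1 ≤ n) (Ωc : Finset (Fin (d + 1) → ℤ)) (y : ↥Ωc)
    (x : ↥(fineDom n Ωc)) :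
    PathRel (fun u v : ↥(fineDom n Ωc) => v.1 ∈ nbrs u.1 ∧ blk n v.1 = y.1) (rbaseEmb hn Ωc y)
      (rstairContour hn Ωc y x) := by
  unfold rstairContour
  split_ifs with hb
  · rw [rbaseEmb, pathRel_pmap_iff (r := fun u v => v ∈ nbrs u ∧ blk n v = y.1)]
    refine pathRel_and (r := fun u v => v ∈ nbrs u) (P := fun v => blk n v = y.1) _ _
      (pathRel_stair (base_le_of_blk hn hb).1) ?_
    intro z hz
    exact blk_of_between hn hb (mem_stair (base_le_of_blk hn hb).1 hz).1 (mem_stair (base_le_of_blk hn hb).1 hz).2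
  · trivial

/-- hypothesis `hlen`: `|Γ_{y,x}| ≤ (d+1)·n`. [folklore] -/
theorem rstairContour_length {n : ℕ} (hn : 1 ≤ n) (Ωc : Finset (Fin (d + 1) → ℤ)) (y : ↥Ωc)
    (x : ↥(fineDom n Ωc)) : ((rstairContour hn Ωc y x).length : ℝ) ≤ (d + 1) * n := by
  unfold rstairContour
  split_ifs with hb
  · rw [List.length_pmap]
    have := length_stair_le (base_le_of_blk hn hb).1 (base_le_of_blk hn hb).2
    exact_mod_cast this
  · simp only [List.length_nil, Nat.cast_zero]
    positivity

/-- **(1.8) FOR REGULAR CONFIGURATIONS ON UNIONS OF UNIT BLOCKS WITH [B4]'S STAIRCASE CONTOURS** —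
`lower18_regular_region` with the contour hypotheses DISCHARGED.
[cite: Balaban1983RegularityDecay, p. 573 (1.8) with p. 572 (1.4), pp. 579–580 (2.23)–(2.27)] -/
theorem lower18_regular_region_stair {ι : Type*} [Fintype ι] [DecidableEq ι] (F : OrthFlow ι) {ℓ : ℝ}
    (hℓ : 0 ≤ ℓ) (hLip : ∀ t (v : ι → ℝ), ((F.U t - 1) *ᵥ v) ⬝ᵥ ((F.U t - 1) *ᵥ v) ≤ (ℓ * t) ^ 2 * (v ⬝ᵥ v))
    (κ : ℝ) {n : ℕ} (hn : 1 ≤ n) {a : ℝ} (ha : 0 ≤ a) (m2 : ℝ) (Ωc : Finset (Fin (d + 1) → ℤ))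
    (A₀c : (Fin (d + 1) → ℤ) → Fin (d + 1) → ℝ) {A : ↥(fineDom n Ωc) → ↥(fineDom n Ωc) → ℝ} {θ : ℝ}
    (hθ : 0 ≤ θ)
    (hA : ∀ u v : ↥(fineDom n Ωc), v.1 ∈ nbrs u.1 → blk n v.1 = blk n u.1 →
      |κ * (A u v - blockConst n (fineDom n Ωc) A₀c u v)| ≤ θ / n)
    (hsmall : ℓ ^ 2 * θ ^ 2 * (d + 1) * (1 + a * (d + 1)) ≤ min 2 a / 4)
    (Φ : ↥(fineDom n Ωc) × ι → ℝ) :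
    (min 2 a / 4 + m2) * (Φ ⬝ᵥ Φ)
      ≤ Φ ⬝ᵥ (b4Op F κ (regWt n (fineDom n Ωc)) m2 (a * ((n : ℝ) ^ (d + 1))⁻¹) (rBlkWt n Ωc (fineDom n Ωc))
          (rbaseEmb hn Ωc) (rstairContour hn Ωc) A *ᵥ Φ) :=
  lower18_regular_region F hℓ hLip κ hn ha m2 Ωc (fun y _ _ => rbaseEmb_blk hn Ωc y)
    (fun y x h => rstairContour_end hn Ωc y x h) (fun y x _ => rstairContour_path hn Ωc y x)
    (fun y x _ => rstairContour_length hn Ωc y x) A₀c hθ hA hsmall Φ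

/-- **LEMMA 2.1 (2.15), FIRST MEMBER, ON UNIONS OF UNIT BLOCKS FOR REGULAR NON-CONSTANT `A`**: the Green's function
`G_k(Ω,A) = (−Δ^{η,N}_{A,Ω} + m² + aP_k(A))^{-1}` exists and `(min(2,a)/4 + m²)²‖G_k(Ω,A)f‖₂² ≤ ‖f‖₂²` (explicit
`c₂ = (min(2,a)/4 + m²)^{-1}`). [cite: Balaban1983RegularityDecay, Lemma 2.1 (2.15) p. 577, first member] -/
theorem green_region_l2_bound {ι : Type*} [Fintype ι] [DecidableEq ι] (F : OrthFlow ι) {ℓ : ℝ} (hℓ : 0 ≤ ℓ)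
    (hLip : ∀ t (v : ι → ℝ), ((F.U t - 1) *ᵥ v) ⬝ᵥ ((F.U t - 1) *ᵥ v) ≤ (ℓ * t) ^ 2 * (v ⬝ᵥ v))
    (κ : ℝ) {n : ℕ} (hn : 1 ≤ n) {a : ℝ} (ha : 0 ≤ a) {m2 : ℝ} (hpos : 0 < min 2 a / 4 + m2)
    (Ωc : Finset (Fin (d + 1) → ℤ)) (A₀c : (Fin (d + 1) → ℤ) → Fin (d + 1) → ℝ)
    {A : ↥(fineDom n Ωc) → ↥(fineDom n Ωc) → ℝ} {θ : ℝ} (hθ : 0 ≤ θ)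
    (hA : ∀ u v : ↥(fineDom n Ωc), v.1 ∈ nbrs u.1 → blk n v.1 = blk n u.1 →
      |κ * (A u v - blockConst n (fineDom n Ωc) A₀c u v)| ≤ θ / n)
    (hsmall : ℓ ^ 2 * θ ^ 2 * (d + 1) * (1 + a * (d + 1)) ≤ min 2 a / 4)
    (f : ↥(fineDom n Ωc) × ι → ℝ) :
    IsUnit (b4Op F κ (regWt n (fineDom n Ωc)) m2 (a * ((n : ℝ) ^ (d + 1))⁻¹) (rBlkWt n Ωc (fineDom n Ωc))
        (rbaseEmb hn Ωc) (rstairContour hn Ωc) A).det ∧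
      (min 2 a / 4 + m2) ^ 2
          * (((b4Op F κ (regWt n (fineDom n Ωc)) m2 (a * ((n : ℝ) ^ (d + 1))⁻¹) (rBlkWt n Ωc (fineDom n Ωc))
                (rbaseEmb hn Ωc) (rstairContour hn Ωc) A)⁻¹ *ᵥ f) ⬝ᵥ
            ((b4Op F κ (regWt n (fineDom n Ωc)) m2 (a * ((n : ℝ) ^ (d + 1))⁻¹) (rBlkWt n Ωc (fineDom n Ωc))
                (rbaseEmb hn Ωc) (rstairContour hn Ωc) A)⁻¹ *ᵥ f))
        ≤ f ⬝ᵥ f :=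
  ⟨isUnit_det_of_form_ge hpos (lower18_regular_region_stair F hℓ hLip κ hn ha m2 Ωc A₀c hθ hA hsmall),
    inv_mulVec_sq_le hpos (lower18_regular_region_stair F hℓ hLip κ hn ha m2 Ωc A₀c hθ hA hsmall) f⟩

end Contour

section Regularity

/-! ## §7 THE PRINTED REGULARITY (1.7) ⇒ THE BLOCKWISE FORM (2.23)

[B4] p. 572: vector fields = real-valued functions on bonds (transcript paraphrase) with «A_{⟨x,x+ηe_μ⟩} = A_μ(x)»;
p. 573 (1.7)
«|(∂^η_μ A)(x)| ≤ c e^{β−1}, x ∈ Ω, μ = 1,…,d, β > 0» with «(∂^η_μA)(x) = η^{−1}(A(x+ηe_μ) − A(x))»; p. 579 (2.23)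
«A = A₀ + A', |A'|, |∂^η_μA'| ≤ c'e^{β−1}», «c' depends on c and M».  In lattice units (1.7) reads
`|A_ν(x + e_μ) − A_ν(x)| ≤ c e^{β−1}/n`; telescoping along the staircase from the base corner of the unit cube
(`≤ (d+1)n` steps) gives `|A_ν(x) − A_ν(n·y)| ≤ (d+1)c e^{β−1}` on `B(y)`, i.e. (2.23) per UNIT cube with
`A₀(Δ) = A(base corner)` and `c' = (d+1)c`. -/

open Literature.MathematicalPhysics.QuantumFieldTheory.Balaban1983to89.B4Reflection242 (nbrs blk mem_nbrs blk_mul)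
open Literature.MathematicalPhysics.QuantumFieldTheory.Balaban1983to89.B4Lower18 (fineDom mem_fineDom)

variable {d : ℕ}

/-- A VECTOR FIELD IN COMPONENT FORM `A_ν(x)` (on all of `ℤ^{d+1}`, lattice units) AS A BOND FUNCTION:
`A(x, x + e_ν) = A_ν(x)`, `A(x + e_ν, x) = −A_ν(x)`, `0` on non-bonds ([B4] p. 572 «A_{⟨x,x+ηe_μ⟩} = A_μ(x)»,
orientation reversal changes the sign). [cite: Balaban1983RegularityDecay, p. 572, dictionary] -/
def compField (Ac : (Fin (d + 1) → ℤ) → Fin (d + 1) → ℝ) (x x' : Fin (d + 1) → ℤ) : ℝ :=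
  (∑ ν, if x' = x + e1 ν then Ac x ν else 0) - (∑ ν, if x = x' + e1 ν then Ac x' ν else 0)

/-- `e_i = e_ν ↔ i = ν`. [folklore] -/
theorem e1_inj {i ν : Fin (d + 1)} : (e1 i : Fin (d + 1) → ℤ) = e1 ν ↔ i = ν := by
  refine ⟨fun h => ?_, fun h => by rw [h]⟩
  by_contra hne
  have hi := congrFun h i
  rw [e1_apply_self, e1_apply_ne hne] at hi
  exact one_ne_zero hi

/-- `x ≠ x + e_i + e_ν`. [folklore] -/
theorem ne_add_e1_add_e1 (x : Fin (d + 1) → ℤ) (i ν : Fin (d + 1)) : ¬ (x = x + e1 i + e1 ν) := by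
  intro h
  have hi := congrFun h i
  simp only [Pi.add_apply, e1_apply_self] at hi
  by_cases hν : i = ν
  · subst hν
    rw [e1_apply_self] at hi
    linarith
  · rw [e1_apply_ne hν] at hi
    linarith

/-- `A(x, x + e_i) = A_i(x)`. [folklore] -/
theorem compField_add (Ac : (Fin (d + 1) → ℤ) → Fin (d + 1) → ℝ) (x : Fin (d + 1) → ℤ) (i : Fin (d + 1)) :
    compField Ac x (x + e1 i) = Ac x i := by
  unfold compField
  have h1 : ∀ ν, (x + e1 i = x + e1 ν) ↔ i = ν := fun ν => by rw [add_right_inj, e1_inj]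
  simp only [h1, ne_add_e1_add_e1 x i, if_false, Finset.sum_const_zero, sub_zero, Finset.sum_ite_eq,
    Finset.mem_univ, if_true]

/-- `A(x + e_i, x) = −A_i(x)`. [folklore] -/
theorem compField_sub (Ac : (Fin (d + 1) → ℤ) → Fin (d + 1) → ℝ) (x : Fin (d + 1) → ℤ) (i : Fin (d + 1)) :
    compField Ac (x + e1 i) x = -Ac x i := by
  unfold compField
  have h1 : ∀ ν, (x + e1 i = x + e1 ν) ↔ i = ν := fun ν => by rw [add_right_inj, e1_inj]
  simp only [h1, ne_add_e1_add_e1 x i, if_false, Finset.sum_const_zero, zero_sub, Finset.sum_ite_eq,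
    Finset.mem_univ, if_true]

/-- the constant field on the bond `(u, u + e_i)` is its `i`-th component. [folklore] -/
theorem constBond_step (A₀ : Fin (d + 1) → ℝ) {R : Finset (Fin (d + 1) → ℤ)} {u v : ↥R} {i : Fin (d + 1)}
    (h : v.1 = u.1 + e1 i) : constBond A₀ Subtype.val u v = A₀ i := by
  unfold constBond
  simp only [h, Pi.add_apply, Int.cast_add, add_sub_cancel_left]
  rw [Finset.sum_eq_single i (fun μ _ hμ => by rw [e1_apply_ne hμ, Int.cast_zero, mul_zero])
    (fun hi => absurd (Finset.mem_univ i) hi), e1_apply_self, Int.cast_one, mul_one]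

/-- the constant field on the reversed bond `(v + e_i, v)` is minus its `i`-th component. [folklore] -/
theorem constBond_step_rev (A₀ : Fin (d + 1) → ℝ) {R : Finset (Fin (d + 1) → ℤ)} {u v : ↥R} {i : Fin (d + 1)}
    (h : u.1 = v.1 + e1 i) : constBond A₀ Subtype.val u v = -A₀ i := by
  unfold constBond
  simp only [h, Pi.add_apply, Int.cast_add, sub_add_cancel_left, mul_neg, Finset.sum_neg_distrib]
  rw [Finset.sum_eq_single i (fun μ _ hμ => by rw [e1_apply_ne hμ, Int.cast_zero, mul_zero])
    (fun hi => absurd (Finset.mem_univ i) hi), e1_apply_self, Int.cast_one, mul_one]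

/-- the steps of a segment go UP by unit vectors. [folklore] -/
theorem pathRel_seg_up (i : Fin (d + 1)) (p : Fin (d + 1) → ℤ) (m : ℕ) :
    PathRel (fun u v : Fin (d + 1) → ℤ => ∃ μ, v = u + e1 μ) p (seg i p m) := by
  induction m generalizing p with
  | zero => trivial
  | succ m ih => exact ⟨⟨i, rfl⟩, ih _⟩

/-- the steps of a staircase go UP by unit vectors. [folklore] -/
theorem pathRel_stairL_up (x : Fin (d + 1) → ℤ) (cs : List (Fin (d + 1))) :
    ∀ p, PathRel (fun u v : Fin (d + 1) → ℤ => ∃ μ, v = u + e1 μ) p (stairL x p cs) := by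
  induction cs with
  | nil => intro p; trivial
  | cons i cs ih =>
      intro p
      rw [stairL, pathRel_append, pathEnd_seg_raise]
      exact ⟨pathRel_seg_up i p _, ih _⟩

/-- **(1.7) ⇒ (2.23) ON A UNIT CUBE BY TELESCOPING**: if `|A_ν(x + e_μ) − A_ν(x)| ≤ δ` for all `x ∈ Ω` then for
every `x ∈ Ω`, `|A_ν(x) − A_ν(n·y(x))| ≤ (d+1)·n·δ` (`y(x)` = the unit cube of `x`, `n·y(x)` its base corner; the
staircase from the corner has `≤ (d+1)n` steps inside the cube). [cite: Balaban1983RegularityDecay, p. 579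
«c' depends on c and M», unit-cube version] -/
theorem abs_comp_sub_base_le {n : ℕ} (hn : 1 ≤ n) (Ωc : Finset (Fin (d + 1) → ℤ))
    {Ac : (Fin (d + 1) → ℤ) → Fin (d + 1) → ℝ} {δ : ℝ} (hδ : 0 ≤ δ)
    (h17 : ∀ x ∈ fineDom n Ωc, ∀ μ ν : Fin (d + 1), |Ac (x + e1 μ) ν - Ac x ν| ≤ δ)
    {u : Fin (d + 1) → ℤ} (hu : u ∈ fineDom n Ωc) (ν : Fin (d + 1)) :
    |Ac u ν - Ac (fun i => (n : ℤ) * blk n u i) ν| ≤ (d + 1) * n * δ := by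
  have hbase := base_le_of_blk hn (rfl : blk n u = blk n u)
  have hpath : PathRel (fun p q : Fin (d + 1) → ℤ => (∃ μ, q = p + e1 μ) ∧ blk n q = blk n u)
      (fun i => (n : ℤ) * blk n u i) (stair (fun i => (n : ℤ) * blk n u i) u) :=
    pathRel_and (r := fun p q : Fin (d + 1) → ℤ => ∃ μ, q = p + e1 μ) (P := fun q => blk n q = blk n u) _ _
      (pathRel_stairL_up u _ _)
      (fun z hz => blk_of_between hn rfl (mem_stair hbase.1 hz).1 (mem_stair hbase.1 hz).2)
  have hpath' := pathRel_chain (r := fun p q : Fin (d + 1) → ℤ => ∃ μ, q = p + e1 μ)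
    (P := fun q => blk n q = blk n u) _ _ (blk_mul hn (blk n u)) hpath
  have hstep : ∀ p q : Fin (d + 1) → ℤ,
      (blk n p = blk n u ∧ ((∃ μ, q = p + e1 μ) ∧ blk n q = blk n u)) → |Ac q ν - Ac p ν| ≤ δ := by
    rintro p q ⟨hp, ⟨μ, rfl⟩, -⟩
    have hpR : p ∈ fineDom n Ωc := by
      rw [mem_fineDom hn, hp]
      exact (mem_fineDom hn).1 hu
    exact h17 p hpR μ ν
  have htel := abs_sub_le_of_pathRel (f := fun p => Ac p ν) hstep _ _ hpath'
  rw [pathEnd_stair hbase.1] at htel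
  have hlen : ((stair (fun i => (n : ℤ) * blk n u i) u).length : ℝ) ≤ (d + 1) * n := by
    have := length_stair_le hbase.1 hbase.2
    exact_mod_cast this
  exact htel.trans (mul_le_mul_of_nonneg_right hlen hδ)

/-- THE BASE-CORNER BACKGROUND: `A₀(Δ(y)) := A(n·y)` (the field's components at the cube's base corner). [folklore] -/
def baseConst (n : ℕ) (Ac : (Fin (d + 1) → ℤ) → Fin (d + 1) → ℝ) : (Fin (d + 1) → ℤ) → Fin (d + 1) → ℝ :=
  fun y => Ac (fun i => (n : ℤ) * y i)

/-- **THE PRINTED REGULARITY (1.7) GIVES THE BLOCKWISE (2.23)**: if `|A_ν(x + e_μ) − A_ν(x)| ≤ δ` on `Ω` then on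
every INTRA-BLOCK nearest-neighbour pair `|A(u,v) − A₀(Δ)(u,v)| ≤ (d+1)nδ` with the base-corner backgrounds.
[cite: Balaban1983RegularityDecay, p. 573 (1.7) ⇒ p. 579 (2.23)] -/
theorem regular17_blockwise {n : ℕ} (hn : 1 ≤ n) (Ωc : Finset (Fin (d + 1) → ℤ))
    {Ac : (Fin (d + 1) → ℤ) → Fin (d + 1) → ℝ} {δ : ℝ} (hδ : 0 ≤ δ)
    (h17 : ∀ x ∈ fineDom n Ωc, ∀ μ ν : Fin (d + 1), |Ac (x + e1 μ) ν - Ac x ν| ≤ δ)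
    (u v : ↥(fineDom n Ωc)) (hnb : v.1 ∈ nbrs u.1) (hblk : blk n v.1 = blk n u.1) :
    |compField Ac u.1 v.1 - blockConst n (fineDom n Ωc) (baseConst n Ac) u v| ≤ (d + 1) * n * δ := by
  obtain ⟨i, h | h⟩ := mem_nbrs.1 hnb
  · have h' : v.1 = u.1 + e1 i := h
    have hc : compField Ac u.1 v.1 = Ac u.1 i := by rw [h']; exact compField_add Ac u.1 i
    have hk : blockConst n (fineDom n Ωc) (baseConst n Ac) u v = Ac (fun j => (n : ℤ) * blk n u.1 j) i :=
      constBond_step _ h'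
    rw [hc, hk]
    exact abs_comp_sub_base_le hn Ωc hδ h17 u.2 i
  · have h' : u.1 = v.1 + e1 i := by
      show u.1 = v.1 + Pi.single i 1
      rw [h, sub_add_cancel]
    have hc : compField Ac u.1 v.1 = -Ac v.1 i := by rw [h']; exact compField_sub Ac v.1 i
    have hk : blockConst n (fineDom n Ωc) (baseConst n Ac) u v = -Ac (fun j => (n : ℤ) * blk n u.1 j) i :=
      constBond_step_rev _ h'
    rw [hc, hk, ← hblk, show -Ac v.1 i - -Ac (fun j => (n : ℤ) * blk n v.1 j) i
      = -(Ac v.1 i - Ac (fun j => (n : ℤ) * blk n v.1 j) i) by ring, abs_neg]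
    exact abs_comp_sub_base_le hn Ωc hδ h17 v.2 i

/-- **(1.8) ON UNIONS OF UNIT BLOCKS IN THE PRINTED PARAMETRISATION WITH THE PRINTED REGULARITY (1.7)**: charge
`e > 0`, `κ = eη = e/n`, a vector field `A_ν(x)` with (1.7) in lattice units `|A_ν(x+e_μ) − A_ν(x)| ≤ c e^{β−1}/n`
for `x ∈ Ω` (i.e. `η^{-1}|A_ν(x + ηe_μ) − A_ν(x)| ≤ c e^{β−1}`), and the smallness
`ℓ²((d+1)c e^β)²(d+1)(1+a(d+1)) ≤ min(2,a)/4`; then `−Δ^{η,N}_{A,Ω} + m² + aP_k(A) ≥ (min(2,a)/4 + m²)I` as forms.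
[cite: Balaban1983RegularityDecay, p. 573 (1.7)–(1.8)] -/
theorem lower18_regular_region_printed {ι : Type*} [Fintype ι] [DecidableEq ι] (F : OrthFlow ι) {ℓ : ℝ}
    (hℓ : 0 ≤ ℓ) (hLip : ∀ t (v : ι → ℝ), ((F.U t - 1) *ᵥ v) ⬝ᵥ ((F.U t - 1) *ᵥ v) ≤ (ℓ * t) ^ 2 * (v ⬝ᵥ v))
    {e : ℝ} (he : 0 < e) {n : ℕ} (hn : 1 ≤ n) {a : ℝ} (ha : 0 ≤ a) (m2 : ℝ) (Ωc : Finset (Fin (d + 1) → ℤ))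
    {Ac : (Fin (d + 1) → ℤ) → Fin (d + 1) → ℝ} {c β : ℝ} (hc : 0 ≤ c)
    (h17 : ∀ x ∈ fineDom n Ωc, ∀ μ ν : Fin (d + 1), |Ac (x + e1 μ) ν - Ac x ν| ≤ c * e ^ (β - 1) / n)
    (hsmall : ℓ ^ 2 * ((d + 1) * c * e ^ β) ^ 2 * (d + 1) * (1 + a * (d + 1)) ≤ min 2 a / 4)
    (Φ : ↥(fineDom n Ωc) × ι → ℝ) :
    (min 2 a / 4 + m2) * (Φ ⬝ᵥ Φ)
      ≤ Φ ⬝ᵥ (b4Op F (e / n) (regWt n (fineDom n Ωc)) m2 (a * ((n : ℝ) ^ (d + 1))⁻¹)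
          (rBlkWt n Ωc (fineDom n Ωc)) (rbaseEmb hn Ωc) (rstairContour hn Ωc)
          (fun u v => compField Ac u.1 v.1) *ᵥ Φ) := by
  have hn0 : (0 : ℝ) < n := by exact_mod_cast hn
  have heβ : 0 ≤ e ^ (β - 1) := Real.rpow_nonneg he.le _
  have hθ : 0 ≤ (d + 1) * c * e ^ β := by
    have : 0 ≤ e ^ β := Real.rpow_nonneg he.le β
    positivity
  refine lower18_regular_region_stair F hℓ hLip (e / n) hn ha m2 Ωc (baseConst n Ac) hθ ?_ hsmall Φ
  intro u v hnb hblk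
  have hδ : 0 ≤ c * e ^ (β - 1) / n := by positivity
  have hreg := regular17_blockwise hn Ωc hδ h17 u v hnb hblk
  rw [abs_mul, abs_of_pos (div_pos he hn0)]
  calc e / n * |compField Ac u.1 v.1 - blockConst n (fineDom n Ωc) (baseConst n Ac) u v|
      ≤ e / n * ((d + 1) * n * (c * e ^ (β - 1) / n)) := mul_le_mul_of_nonneg_left hreg (div_pos he hn0).le
    _ = (d + 1) * c * e ^ β / n := by
        rw [rpow_eq_rpow_sub_one_mul he β]
        field_simp

end Regularity

section Family

/-! ## §8 THE TYPED (1.8) `B4.Claim18Printed` ON THE REGULAR-REGION FAMILY (unions of unit blocks, printed (1.7), `A ≠ 0`)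

The family is indexed by `(n, Ωc, e, A)`: scale `n = L^k`, an ARBITRARY finite set `Ωc ⊂ ℤ^{d+1}` of unit labels
(`Ω = ⋃_{y∈Ωc} B(y)`; [B4]'s `Ω` are unions of big blocks, a sub-case), charge, and a vector field in component
form on the whole lattice; `regular` := the printed (1.7) in lattice units on `Ω`; `lower18 γ` := the form
inequality for [B4]'s operator (1.6) (mass `0`) on `Ω` with `κ = e/n`, Neumann bonds of `Ω`, staircase contours. -/

open Literature.MathematicalPhysics.QuantumFieldTheory.Balaban1983to89.B4 (EtaSetting Claim18Printed)
open Literature.MathematicalPhysics.QuantumFieldTheory.Balaban1983to89.B4Lower18 (fineDom)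

variable {ι : Type} {d : ℕ}

/-- AN INSTANCE of the regular-region family: scale `n ≥ 1`, unit labels `Ωc`, charge `e`, vector field `A_ν(x)` in
component form — NO hypothesis. [folklore] -/
structure RegularRegionInstance (d : ℕ) where
  n : ℕ
  hn : 1 ≤ n
  Ωc : Finset (Fin (d + 1) → ℤ)
  e : ℝ
  Ac : (Fin (d + 1) → ℤ) → Fin (d + 1) → ℝ

/-- THE REGULAR-REGION CARRIER of `B4.EtaSetting` (flow `F` and the constants `a, c, β` are family parameters):
`e` := the instance's charge; `regular` := (1.7) «|(∂^η_μ A)(x)| ≤ c e^{β−1}, x ∈ Ω, μ = 1,…,d, β > 0» in lattice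
units, `|A_ν(x + e_μ) − A_ν(x)| ≤ c e^{β−1}/n` for `x ∈ Ω`; `lower18 γ` := `∀ Φ, γ|Φ|² ≤ ⟨Φ, (−Δ^{η,N}_{A,Ω} +
a_kP_k(A))Φ⟩` with `U = F.U((e/n)·)`, `a_k = a·n^{-(d+1)}`, staircase contours; the other fields are placeholders
not read by (1.8). [cite: Balaban1983RegularityDecay, (1.7)–(1.8) p. 573] -/
noncomputable def regularRegionSetting [Fintype ι] [DecidableEq ι] (F : OrthFlow ι) (a c β : ℝ)
    (i : RegularRegionInstance d) : EtaSetting where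
  Site := ↥(fineDom i.n i.Ωc) × ι
  Dir := Fin (d + 1)
  Src := ↥(fineDom i.n i.Ωc) × ι → ℝ
  e := i.e
  regular := ∀ x ∈ fineDom i.n i.Ωc, ∀ μ ν : Fin (d + 1), |i.Ac (x + e1 μ) ν - i.Ac x ν| ≤ c * i.e ^ (β - 1) / i.n
  bigBlocks := True
  rect := True
  pdist := fun _ _ => 0
  sdist1 := fun _ _ => 0
  sdist2 := fun _ _ _ => 0
  bdist1 := fun _ => 0
  bdist2 := fun _ _ => 0
  bdistS := fun _ => 0
  supNorm := fun _ => 0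
  l2Norm := fun f => Real.sqrt (f ⬝ᵥ f)
  ssdist := fun _ _ => 0
  lhs19 := fun _ _ _ _ _ => 0
  valDG := fun _ _ _ => 0
  valG := fun _ _ => 0
  dlhs19 := fun _ _ _ _ _ => 0
  dvalDG := fun _ _ _ => 0
  dvalG := fun _ _ => 0
  lower18 := fun γ => ∀ Φ : ↥(fineDom i.n i.Ωc) × ι → ℝ,
    γ * (Φ ⬝ᵥ Φ) ≤ Φ ⬝ᵥ (b4Op F (i.e / i.n) (regWt i.n (fineDom i.n i.Ωc)) 0
      (a * ((i.n : ℝ) ^ (d + 1))⁻¹) (rBlkWt i.n i.Ωc (fineDom i.n i.Ωc)) (rbaseEmb i.hn i.Ωc)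
      (rstairContour i.hn i.Ωc) (fun u v => compField i.Ac u.1 v.1) *ᵥ Φ)
  pair := fun _ _ _ _ _ => 0
  dpair := fun _ _ _ _ _ => 0

/-- the carrier's charge is the instance's coordinate. [folklore] -/
theorem regularRegionSetting_e [Fintype ι] [DecidableEq ι] (F : OrthFlow ι) (a c β : ℝ)
    (i : RegularRegionInstance d) : (regularRegionSetting F a c β i).e = i.e := rfl

/-- the carrier's `regular` reads: (1.7) in lattice units on `Ω`. [folklore] -/
theorem regularRegionSetting_regular_iff [Fintype ι] [DecidableEq ι] (F : OrthFlow ι) (a c β : ℝ)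
    (i : RegularRegionInstance d) : (regularRegionSetting F a c β i).regular ↔
      ∀ x ∈ fineDom i.n i.Ωc, ∀ μ ν : Fin (d + 1), |i.Ac (x + e1 μ) ν - i.Ac x ν| ≤ c * i.e ^ (β - 1) / i.n :=
  Iff.rfl

/-- the carrier's `lower18 γ` reads: `∀ Φ, γ|Φ|² ≤ ⟨Φ, H_A(m² = 0)Φ⟩` on `Ω` with `κ = e/n`. [folklore] -/
theorem regularRegionSetting_lower18_iff [Fintype ι] [DecidableEq ι] (F : OrthFlow ι) (a c β : ℝ)
    (i : RegularRegionInstance d) (γ : ℝ) : (regularRegionSetting F a c β i).lower18 γ ↔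
      ∀ Φ : ↥(fineDom i.n i.Ωc) × ι → ℝ,
        γ * (Φ ⬝ᵥ Φ) ≤ Φ ⬝ᵥ (b4Op F (i.e / i.n) (regWt i.n (fineDom i.n i.Ωc)) 0
          (a * ((i.n : ℝ) ^ (d + 1))⁻¹) (rBlkWt i.n i.Ωc (fineDom i.n i.Ωc)) (rbaseEmb i.hn i.Ωc)
          (rstairContour i.hn i.Ωc) (fun u v => compField i.Ac u.1 v.1) *ᵥ Φ) :=
  Iff.rfl

/-- **THEOREM ((1.8) TYPED, ON THE REGULAR-REGION FAMILY: ALL UNIONS OF UNIT BLOCKS, PRINTED REGULARITY,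
NON-CONSTANT FIELDS)**: for a Lipschitz orthogonal flow, `a > 0`, `c ≥ 0`, `β > 0`, the printed claim
`B4.Claim18Printed` — «there exists a positive constant γ₀ such that for e sufficiently small and for a regular
vector field A (1.8) −Δ^{η,N}_{A,Ω} + aP_k(A) ≥ γ₀ I.», «The constant γ₀ is independent of the lattice spacing η, as
well as of Ω and of A.» — HOLDS on the family `regularRegionSetting F a c β` of ALL scales, ALL finite unions of unit
blocks, charges and vector fields, with the witnesses `γ₀ = min(2,a)/4` and the explicit `e₁` of
`B4Lower18Regular.threshold_exists` (for `c' = (d+1)c`).  HONEST LABEL: `γ₀`'s VALUE is the lineage's (the paper's is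
unspecified); the torus variant of p. 572 and the `|∂^η_μA'|` member of (2.23) are not used. [cite:
Balaban1983RegularityDecay, p. 573 (1.8)] -/
theorem claim18Printed_regularRegion [Fintype ι] [DecidableEq ι] (F : OrthFlow ι) {ℓ : ℝ} (hℓ : 0 ≤ ℓ)
    (hLip : ∀ t (v : ι → ℝ), ((F.U t - 1) *ᵥ v) ⬝ᵥ ((F.U t - 1) *ᵥ v) ≤ (ℓ * t) ^ 2 * (v ⬝ᵥ v))
    {a : ℝ} (ha : 0 < a) {c : ℝ} (hc : 0 ≤ c) {β : ℝ} (hβ : 0 < β) :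
    Claim18Printed (regularRegionSetting (d := d) F a c β) := by
  obtain ⟨e₁, he₁, hsm⟩ := threshold_exists ℓ ((d + 1) * c) ha hβ d
  refine ⟨min 2 a / 4, e₁, div_pos (lt_min two_pos ha) four_pos, he₁, ?_⟩
  intro i hreg he hle Φ
  change 0 < i.e at he
  change i.e ≤ e₁ at hle
  have hsm' : ℓ ^ 2 * ((d + 1) * c * i.e ^ β) ^ 2 * (d + 1) * (1 + a * (d + 1)) ≤ min 2 a / 4 := by
    have := hsm i.e he hle
    simpa only [mul_assoc] using this
  have h := lower18_regular_region_printed F hℓ hLip he i.hn ha.le 0 i.Ωc hc hreg hsm' Φ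
  simpa only [add_zero] using h

/-- (1.8) typed on the regular-region family for the ROTATION FLOW (`N = 2`, `ℓ = 1`): a hypothesis-free instance
of the flow assumptions. [cite: Balaban1983RegularityDecay, p. 573 (1.8)] -/
theorem claim18Printed_regularRegion_rot {a : ℝ} (ha : 0 < a) {c : ℝ} (hc : 0 ≤ c) {β : ℝ} (hβ : 0 < β) :
    Claim18Printed (regularRegionSetting (d := d) OrthFlow.rot a c β) :=
  claim18Printed_regularRegion OrthFlow.rot zero_le_one rot_lipschitz ha hc hβ

end Family

end Literature.MathematicalPhysics.QuantumFieldTheory.Balaban1983to89.B4Lower18RegularRegion
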